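import Mathlib
import HarnessLib
import HarnessLib.Audit
import Summits.AtomisticToContinuum.Statement
import Literature.Analysis.FluidPDE.HardSphereCollisionRecord
import Summits.AtomisticToContinuum.HydrodynamicLimit.Theorems.ImplosionDichotomyHsEosLowDensity
import HarnessLib.Audit.Status.Attr

/-!
Route: OneFlightGossipEngine

CLOSED (refuted) 2026-08-20T06:49:33Z by gate — reason: refuted:stmt-AtomisticToContinuum-17700 (BandCoherenceLDAlongFamilies) by Summit.AtomisticToContinuum.HydrodynamicLimit.Theorems.OneFlightGossipEngineBandCoherenceLDAlongFamilies_refuted — note: repair grace of 72.0 h (deadline 2026-08-20T06:47:02Z) expired without a repair — closed by the gate. The file is kept as the record of this route; refuted decls are indexed as negative knowledge (`ledger negatives`).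

# Route OneFlightGossipEngine — one-flight hyperbolicity (ℓ/ε ≍ σ⁻³) isotropises collision kicks
given a coarse past; gossip + isotropic kicks give N-uniform decorrelation of the kinetic Euler
currents; TRANSFER-clamped collisional currents dock them into Yau's entropy clock

It suffices to show X_OF = B1′ ∧ KCWF ∧ LCT ∧ KCWF-Q ∧ CAT ∧ SEET ∧ EAT (rev 35, route-repair
2026-08-17 after the Lean refutation of the
rev-32 crux #5 BCL = BandCoherenceLDAlongFamilies, stmt-17700, by
`Theorems.OneFlightGossipEngineBandCoherenceLDAlongFamilies_refuted`
@ d302ca5584d5 — the GALILEAN-BOOST witness, class refuted-misstated: at the FIXED tilt (8Θ̄K₁)⁻¹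
with ∀η the coherent-band functional
responds LINEARLY (≈ 5D per particle) to a conserved drift D·e₀ of the flow-invariant homogeneous
reference law whose entropy cost
(N+1)D²/2θ is QUADRATIC, so its scale-N pressure is ≥ 25/(128K₁²) > 0 for every τ, N. The band of
the suprathermal heat-flux remainder is
therefore no longer normed particle by particle and split by coherence: it is paid SIGNED, as the
Nachtergaele–Yau truncation
(b·w)G_b(x,|w|²) re-orthogonalised to the collision invariants 1, v, |v|² — a member of the
kinetic-currents class of growth C_B·K₁ — by the
two-sided entropy inequality at the K₁-scaled tilt β₀/(C_B K₁), which needs the kinetic window LD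
with a tilt threshold UNIFORM over the
normalised class: the new crux #5 KCWF-Q. This is repair R1 of the crux ideators of 17700 (k1
`mazur-shifted-band-current`, k2
`IdeatorTwoBoostWitnessAndRepair` §6) and exactly the input cone of the sibling heart line after its
reshape around BCL
(Cruxes/HydroLimitInBand/Lines/IdeatorOneSketch.lean v16, landed defs
`Theorems.HydroLimitInBandSignedBand.*`, 2026-08-17T06:59Z).
ENGINE (this route's own content). B1′ = OneFlightLayeredChaos (crux, rank 2): for hard-sphere flows
on 𝕋³ at fixed small reduced density σ
under the global Gibbs law, conditionally on the r_N-coarse past of ALL particles and the identity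
of the next partner, the outgoing direction
of a tagged particle's next collision inside a kinetic window is uniform on S² up to C·σ^p,
uniformly in N ≥ N₀ (one-flight standard pairs,
expansion 1 + 2L/ε ≍ σ⁻³ per flight, constant scattering Jacobian ε²/4, corrected for shadowing by
near-miss third spheres). Consumption is
exact: hard-sphere kinematics is "pairwise averaging + isotropic kick", so expected traceless second
moments after an exogenous schedule equal
those of the GOSSIP-averaged velocities (support GossipStressIdentity, PROVED) and one collision
damps the pair heat flux by 2/3 and splits it
evenly (support KacPairHeatFlux, PROVED); odd-in-w class members — the signed band current among
them — are the EASY half of the class for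
the engine (outside the kernel {1, w, |w|²} of the tagged-particle collision operator, strictly
contracted per fresh collision).
THE SEVEN CRUXES OF `closes` (three reference-law window LDs the engine attacks + three true-law
a-priori TAIL bounds + the dock glue):
KCWF = KineticCurrentsLDAlongFamilies (rank 3, THE DOCKING NODE): the finite-kinetic-window LD at
scale N for the restricted class
Σ A_jk(x)w_jw_k + (b(x)·w)G(x,|w|²) from LOCAL Gibbs data, η₀-uniform and uniform along jointly
continuous one-parameter families, member-wise
tilt threshold ∃β₀(F) (Iff.rfl with the heart's KineticCurrentsWindowLDFamily; consumed by the
kinetic instance KC1 of the ledger).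
KCWF-Q = KineticCurrentsLDAlongFamiliesQ (rank 5, THE QUANTITATIVE DOCKING NODE, replaces BCL): the
same LD with the tilt threshold UNIFORM
over the normalised class — ∃β₀ BEFORE the weights (A,b,G), growth constant C entering as |β|·C ≤ β₀
(byte-identical, Iff.rfl, with the heart's
registered stub `HydroLimitInBandSignedBand.KineticCurrentsLDAlongFamiliesQ`; KCWF-Q ⟹ KCWF by the
landed sorry-free `kcwf_of_kcwfQ`, so a
proof of #5 closes #3 and the open kinetic content is ONE statement). It passes the
boost/shear/heating soft-mode tests that killed BCL: first
order zero by ⊥ 1, v, |v|²; second order bounded by C × Gaussian moments uniformly over the class,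
beaten by the entropy Hessian for β₀ ≲ θ_min.
LCT = LocalClampedTransferLDAlongFamilies (rank 4, THE REPAIRED COLLISIONAL NODE): the collisional
momentum/energy-transfer window LD with the
TRANSFER-activity clamp act_i = (σ/τ)Σ(‖Δv_i‖ + |Δ‖v_i‖²|/2) ≤ V on both partners, EOS-projected
with x-frozen coefficients Z(ρ₀σ³), Z′(ρ₀σ³),
ρ₀ = rhoLim(profileOf a_s), centred, under local Gibbs data along families (where the refuted
momentum-clamped 13733 does not propagate: the
Newton-cradle relay's ≈ ε_N V_p² energy per collision is counted by the transfer activity;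
constant-family rung = TwoClocks' C′ 16623).
SEET = SuperExponentialEnergyTails (rank 7): E_true[(N+1)⁻¹Σ|v_i|³1{|v_i|>K}] ≤ e^{−cK} + ε for
every rate c, pre-shock, fixed-time
marginals only — the rate form of ECT (ECT ⇐ SEET at rate one, landed seet_imp_energyCurrentTails),
paying the top |w| > K₁ of the remainder
AND its Gaussian-small re-orthogonalisation defect, so that K₁ is chosen after the accuracy
(tightness record: the Gaussian-rate strengthening
is false at s = 0, Theorems/SuperExponentialEnergyTails/Negative/GaussianRateFalse.lean — the
exponential-rate family is the right one).
CAT = CollisionActivityTails (rank 6, stmt-13734) and EAT = EnergyActivityTails (rank 8, CAT's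
energy twin): a-priori L¹ tails of the window
momentum- resp. energy-TRANSFER activity under the TRUE pre-shock law — together exactly the price
of the transfer clamp (landed
TransferClampRemainder p100385, window continuity p118327).
DOCK-Q = ClampedTransferDockOfInputsQ (rank 11, glue, OPEN — provable plumbing once the heart's v16
stubs land): SEET → KCWF-Q → LCT → EAT →
KCWF → CAT → HydrodynamicLimit (guarded conjunct): Yau's Liouville-invariant relative entropy along
the explicit reference family
a_s = ρ_s·Rf(σ³ρ_s) with ONE common window — the shared HEART (landed: per-window estimate p136014,
D-shape ledger end p139514, window
continuity p118327, a-priori bound p109679, reduction p97252, dock p97115) with the cubic channel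
re-threaded SIGNED: BandShiftStatics
(static Gaussian analysis), KineticInstanceOrth (re-export of the landed KC1), CubicChannelRateS
(two-sided entropy inequality at tilt
β₀/(C_B K₁)), WindowClauseRateS (conclusion byte-identical with the landed rate window clause
p139114) — the four registered provable stubs of
Cruxes/HydroLimitInBand/Lines/IdeatorOneSketch.lean v16, whose composition `HydroLimitInBand_of`
consumes exactly {KCWF-Q, SEET, LCT, EAT, CAT};
our DOCK-Q is that composition with KCWF kept as an explicit (implied) antecedent, one Iff.rfl
transport away.
Left in the file as RECORDS / SUPPORTS (not binders): the refuted BCL (17700) and the rev-32 dock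
over it ClampedTransferDockOfInputs (17733,
proved over the false BCL) — both OUT OF THE CONE since rev 37 and superseded by #5/#11, but still
ACTIVE entries: their `--drop` (which is what
clears BROKEN) is bounced by the D-0019 cap check on this legacy over-cap route (8 cruxes / 20
items) — operator/tenure action requested, see the
attached REPAIR-rev35.md §STATE/BLOCKER; the rev-29 dock ClampedTransferDock (17615, KCWF → CAT
→ ECT → HL); EnergyCurrentTails (9235, implied by SEET); KineticCurrentsWindowLDUniform (14662,
pointwise rung of KCWF); the equilibrium rungs
9531/9532 (9532 = the second-cumulant rung of the signed band current at global Gibbs); the engine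
contract GossipConsumptionGlue (16766,
B1′ → KCWF); DiluteSelfConsistency (3091); the PROVED 0768/14445/9533/9534; earlier docks/frames.
Lean: `OneFlightLayeredChaos ∧ KineticCurrentsLDAlongFamilies ∧ LocalClampedTransferLDAlongFamilies
∧ KineticCurrentsLDAlongFamiliesQ ∧ CollisionActivityTails ∧ SuperExponentialEnergyTails ∧
EnergyActivityTails`

## Assembly
The deciding theorem (glue.lean, sorry-free, CRUX-ONLY, rev 35): `closes (hK :
KineticCurrentsLDAlongFamilies) (h₇ : CollisionActivityTails)
(h₃ : LocalClampedTransferLDAlongFamilies) (hQ : KineticCurrentsLDAlongFamiliesQ) (hS :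
SuperExponentialEnergyTails) (h₄ : EnergyActivityTails)
(hD : ClampedTransferDockOfInputsQ) : _root_.HydrodynamicLimit := hD hS hQ h₃ h₄ hK h₇`. Every
binder is a top-level crux and is consumed; hK is
implied by hQ (kcwf_of_kcwfQ) and kept because the ledger's kinetic instance consumes KCWF by name,
so the open content of the cone is
{KCWF-Q, LCT, CAT, SEET, EAT} plus the plumbing glue DOCK-Q. OneFlightLayeredChaos (rank 2) is the
mechanism that is to PRODUCE hQ (hence hK;
engine contract GossipConsumptionGlue := B1′ → KCWF, the class-uniform β₀ being what a
forecast-ledger proof naturally yields) and is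
deliberately not a binder, so the route closes whichever way the docking node is reached. The frame
item Assembly (OneFlightLayeredChaos →
KCWF → CAT → ECT → HL, rev 29) is unchanged: it is OneFlightLayeredChaos → ClampedTransferDock
definitionally.

### 1 · Assembly · assembly
Lean: `OneFlightLayeredChaos → KineticCurrentsLDAlongFamilies → CollisionActivityTails →
EnergyCurrentTails → _root_.HydrodynamicLimit`

Rationale: WHY THIS LINE. The card's mechanism: at packing φ = σ³ the free flight is ℓ ≍ ε/φ long, so ONE
flight followed by a dispersing collision
expands post-collisional direction families by ≍ φ⁻¹ (Krylov's ℓ/a amplification; Sinai fronts;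
Dorfman1999 Ch. 18), and in d = 3 hard-sphere
scattering maps a uniform impact parameter to a uniform outgoing relative direction with CONSTANT
Jacobian ε²/4, so a Chernov–Dolgopyat
standard-pair step (ChernovDolgopyat2009; doi:10.1007/s00023-007-0351-7; programme
doi:10.4171/022-2/80) is two-body along the family — small
fixed density is a hyperbolicity parameter, not an expansion parameter. Two things are this route's
own: (1) B1′ conditions every particle at
a resolution r ≫ ε because near-miss third spheres shadow lunes of the target disc (the typed
OneFlightLayeredChaos, stmt-14535, large N only;
the N = 1 periodic Lorentz gas is genuinely non-uniform, MarklofStrombergsson2011); (2) consumption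
is EXACT: hard-sphere kinematics is
"pairwise averaging + isotropic kick", so expected traceless second moments after an exogenous
schedule equal those of the GOSSIP-averaged
velocities (GossipStressIdentity, PROVED; doi:10.1109/tit.2006.874516) and one collision damps the
pair heat flux by 2/3 (KacPairHeatFlux,
PROVED; doi:10.1512/iumj.1956.5.55001, doi:10.1007/bf02392695). Imported areas: hyperbolic billiards
(standard pairs), distributed consensus
(products of averaging matrices), Kac's programme; the dock is OllaVaradhanYau1993/Yau1991 with the
Nachtergaele–Yau momentum truncation of
the energy current (NachtergaeleYau2003 §5, §7) and Mazur's projection on the conserved quantities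
(doi:10.1016/0031-8914(69)90185-2) for the
band. HISTORY (short; revisions log has the detail). Rev 19–27: the shared collisional crux 13733
(momentum-activity clamp) was REFUTED IN LEAN
(Newton-cradle energy relay; refuted-misstated, repair = TRANSFER clamp, TwoClocks' 16623); the dock
line (> 40 landed files) PROVED Yau's
one-window ledger (the HEART). Rev 29: statement re-type D-0032 (packing guard = hypothesis of the
conjunct), DiluteSelfConsistency left the
cone. Rev 32 (judge-repair): the dock opened into its four real inputs LCT, BCL, SEET, EAT + the
provable dock over them (17733, proved).
Rev 35 (THIS REPAIR, 2026-08-17): BCL (17700) REFUTED IN LEAN at 06:47Z by the Galilean-boost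
witness (refuter cdisprove/rattack-17700 and both
crux ideators independently; class refuted-misstated): a fixed-tilt scale-N exponential bound
tolerates only functionals with ZERO first-order
response to the hydrodynamic soft modes of the reference family, and the coherence indicator with
threshold η → 0 turned the second-order
object ‖q̄‖ into a first-order trigger (BN-17700-1). The refuter's literal C′ (tilt chosen after ε)
is NOT filed: an LLN-scale tilt cannot feed
the entropy-method Grönwall (the ledger divides by the tilt; β(ε) ≲ √ε forces ε·β⁻¹e^{t/β} → ∞ —
ideator k2 §4, kernel-side `band_expectation`).
Filed instead is R1, the repair both sibling lines already build on: KCWF-Q (#5, stmt-18052) and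
DOCK-Q (#11, stmt-18054) filed at rev 36 and `closes`
re-certified over them at rev 37 (glue_ok). STILL BROKEN at hand-off: deactivating the refuted 17700
(and 17733) needs `--drop`/`--restate`, which
the gate's D-0019 cap check bounces for this legacy over-cap route (post-edit 8 cruxes / 20 items;
`aside` refused by this gate, `--split` refused
off the final cycle, further drops break landed files incl. the heart) — the prepared operator edit
(drop ×2 [+ KCWF → support, 6-binder closes
glue2.lean]) is attached as evidence (REPAIR-rev35.md, edit4_operator.json).

RANKED CRUXES. #2 OneFlightLayeredChaos (stmt-14535, typed) — one-flight angular chaos per collision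
given the kinetic-scale coarse past at
global Gibbs, |P(W∩A∩E) − u(B)·P(W∩E)| ≤ Cσ^p for every event E of the coarse-past σ-algebra,
uniformly in N ≥ N₀(σ,ρ,τ,n). The MECHANISM crux:
it is to produce #3/#5 and is not a binder of `closes`. (why it might fail: N-uniform log-Lipschitz
regularity at scale ε of flight-start
laws given cells + exact velocities of all particles; in print only two-body or one 3-D particle;
recollision chains may pin impact parameters
on events of mass ≫ σ^p.) [ChernovDolgopyat2009, doi:10.4171/022-2/80, BalintToth2008,
MarklofStrombergsson2011, BGSSCPAM2023]
#3 KineticCurrentsLDAlongFamilies (stmt-16659; THE DOCKING NODE) — ∃η₀ ∀ jointly continuous families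
(a_s,θ_s,u_s; A_s,b_s,G_s) with σ³·sup a_s ≤
η₀∫a_s on [0,t₁] ∀Φ: class bound, orthogonality to 1,v,|v|² ⇒ ∃β₀ ∀|β|≤β₀ ∀ε ∃τ₀ ∀τ≥τ₀ ∃N₀ ∀N
∀s∈[0,t₁]: ∫exp(βΣ_i w⁻¹∫₀^w F_s) dλ^N_s ≤ e^{ε(N+1)},
w = τ(N+1)^{-1/3}, REFERENCE law λ^N_s = local Gibbs along the family. (why it might fail: all
scaled cumulants must vanish at scale N with thresholds
uniform along families; ring-induced heavy tails of the kick martingale; no print at fixed density,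
open even at global Gibbs.)
[OllaVaradhanYau1993, KipnisLandim1999, BGSSCPAM2023, BGSSAnnals2023, doi:10.1109/tit.2006.874516]
#4 LocalClampedTransferLDAlongFamilies (stmt-17691; THE REPAIRED COLLISIONAL NODE) — ∃η₀ ∀t₁ ∀
families ∀σ<1/2 with the packing guard ∀Φ ∀ smooth
test families φ ∃V₀ ∀V ∃β₀ ∀β ∀ε ∃τ₀ ∀τ ∃N₀ ∀N ∀s∈[0,t₁]: the three momentum rows and the energy row
of the window collisional transfer current,
clamped per collision by ω_iω_j, ω_i = 1{act_i ≤ V}, act_i = (σ/τ)Σ(‖Δv_i‖ + |Δ‖v_i‖²|/2) the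
TRANSFER activity, minus the EOS projections with
x-frozen Z(ρ₀σ³), Z′(ρ₀σ³), ρ₀ = rhoLim(profileOf a_s), and the deterministic centrings, have
exponential moments ≤ e^{ε(N+1)} under the REFERENCE
law; constant-family rung = TwoClocks' C′ 16623 (kernel-checked clampedTransferWindowLD_of_family).
(why it might fail: no N-uniform exp-moment
control of clamped collisional currents beyond Lanford's time at fixed σ³ (F1); the clamp-deficit
static residual needs a tagged transfer-activity
LLN (F2); a relay/cage passing the TRANSFER clamp in one row, or EOS missing the static response
near η₀.)
[OllaVaradhanYau1993, Spohn1991, SalsburgWood1962, Serre2021, Yau1991,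
Theorems.OneFlightGossipEngineEquilibriumClampedCollisionalWindowLD_refuted]
#5 KineticCurrentsLDAlongFamiliesQ (NEW, replaces the refuted 17700 1:1; KCWF-Q) — #3 with the tilt
threshold UNIFORM over the normalised class:
∃η₀ ∀t₁ ∀ families with the guard ∀σ ∀Φ ∃β₀ ∀(A,b,G) continuous ∀C>0 with |F_s| ≤ C(1+|v|²) on
[0,t₁], F ⊥ 1, v_j, |v|² under M_(1,u_s(x),θ_s(x))
∀β with |β|·C ≤ β₀ ∀ε ∃τ₀ ∀τ≥τ₀ ∃N₀ ∀N≥N₀ ∀s∈[0,t₁]: ∫exp(βΣ_i w⁻¹∫₀^w F_s(x_i,v_i)) dλ^N_s ≤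
e^{ε(N+1)} (byte-identical with the heart's registered stub
`HydroLimitInBandSignedBand.KineticCurrentsLDAlongFamiliesQ`; ⟹ #3 by the landed `kcwf_of_kcwfQ`).
What consumes the explicit tilt: the SIGNED
band remainder (b·w)G_b of growth C_B·K₁ at tilt β₀/(C_B K₁), Grönwall constant ∝ K₁/β₀, beaten by
SEET's every-rate top — the Nachtergaele–Yau
shape |p|³1{|p|≤M} ≤ M p², tilt δ/M. Soft-mode audit (this seat): boost/shear/heating/density
responses vanish at first order by the three
orthogonality rows and are ≤ C·(Gaussian moments of order ≤ 6)·D² at second order uniformly over the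
class, so a class-uniform β₀(θ_min, Θ̄,
sup‖u‖) is consistent; static ceiling finite for β₀ < 1/(4Θ̄(1+sup‖u‖²)); the ∫-junk loophole is
closed (F continuous, quadratic growth,
Maxwellian moments). (why it might fail: as #3 PLUS uniformity — a sequence of normalised class
members (growth 1) whose window pressure at a
common tilt decays arbitrarily slowly in τ (slow odd modes near the kernel of the tagged-particle
collision operator), or a second-order
soft-mode response not dominated by C uniformly; no print at fixed density.) [OllaVaradhanYau1993,
NachtergaeleYau2003, KipnisLandim1999,
doi:10.1016/0031-8914(69)90185-2, doi:10.1214/aop/1176993225, BGSSCPAM2023,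
Theorems.OneFlightGossipEngineBandCoherenceLDAlongFamilies_refuted]
#6 CollisionActivityTails (shared stmt-13734) — a-priori L¹ tails of the window momentum-transfer
activity under the TRUE pre-shock law. (why it
might fail: no extensive a-priori bound on collision impulses under a non-equilibrium hard-sphere
law; o(N) entropy tolerates o(N) caged
particles of unbounded activity.) [Serre2021, Serre2024, OllaVaradhanYau1993,
BuragoFerlegerKononenko1998]
#7 SuperExponentialEnergyTails (stmt-17701) — ∀t<T ∀c>0 ∃K₀ ∀K≥K₀ ∀ε ∃N₀ ∀N ∀s≤t:
E_true[(N+1)⁻¹Σ_i|v_i(s)|³1{|v_i(s)|>K}] ≤ e^{−cK} + ε (fixed-time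
marginals; ⇒ ECT at rate one; known at s = 0 and under HighMomentumCutoff; tight: the Gaussian-rate
version is false at s = 0). (why it might
fail: stronger than ECT — super-exponential decay in K under the TRUE law uniformly in N; entropy
O(N) alone lets energy ~N sit on N^{1/3} fast
particles (HighMomentumCutoffBarrier); only dynamics can forbid it — no tool.) [OllaVaradhanYau1993,
NachtergaeleYau2003,
Varadhan1993EntropyMethods,
Literature.Barriers.AtomisticToContinuum.HighMomentumCutoffBarrierNarrow]
#8 EnergyActivityTails (stmt-17703; CAT's energy twin) — ∀t<T ∃V₀ ∀V ∀ε ∃τ₀ ∀τ ∃N₀ ∀N ∀s≤t: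
E_true[(N+1)⁻¹Σ a^e_i 1{a^e_i > V}] ≤ ε,
a^e_i = (σ/τ)Σ_{collisions of i in (s,s+w]}|Δ‖v_i‖²|/2. (why it might fail: dynamical, like 13734 —
no extensive a-priori bound on collisional
ENERGY transfer under a non-equilibrium law; o(N) entropy tolerates o(N) caged/platooned particles
exchanging unbounded energy in one window.)
[Serre2021, Serre2024, OllaVaradhanYau1993, BuragoFerlegerKononenko1998,
CercignaniIllnerPulvirenti1994]
#11 ClampedTransferDockOfInputsQ (NEW, replaces 17733 1:1; DOCK-Q, glue) — #7 → #5 → #4 → #8 → #3 →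
#6 → HydrodynamicLimit. OPEN but plumbing-grade:
it is the composition `HydroLimitInBand_of` of the heart's skeleton v16
(Cruxes/HydroLimitInBand/Lines/IdeatorOneSketch.lean; inputs exactly
{KCWF-Q, SEET, LCT, EAT, CAT}) once its four registered provable stubs land — BandShiftStatics
(re-orthogonalised band truncation, static),
KineticInstanceOrth (KC1 with its cut-off's momentum-orthogonality exported), CubicChannelRateS (the
signed rate cubic channel, lead 9133-c17),
WindowClauseRateS (D-shape window clause, conclusion byte-identical with the landed p139114 so the
landed ledger end p139514 applies) — then one
Iff.rfl transport as in Theorems/OneFlightGossipEngineClampedTransferDockOfRouteItems.lean.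
Crux-kind only because binders of `closes` must be
cruxes. (why it might fail: only through a typing slip in the signed channel — e.g. the
re-orthogonalisation defect ρ·ω₀ not being a Gaussian
tail bookable with the top, or WindowClauseRateS's conclusion drifting from the landed clause;
mathematically it is modus ponens over the heart.)
[Yau1991, OllaVaradhanYau1993, NachtergaeleYau2003, KipnisLandim1999]
Records / supports (not binders): BandCoherenceLDAlongFamilies (17700, REFUTED — negative edge) and
ClampedTransferDockOfInputs (17733, proved
over it) replaced by #5/#11; ClampedTransferDock (17615, rev-29 dock); EnergyCurrentTails (9235, ⇐
#7); GossipStressIdentity (9533),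
KacPairHeatFlux (9534), HsEosLowDensity (0768), UniformLocalGibbsConcentration (14445) — PROVED;
EquilibriumStressVarianceDecay /
EquilibriumHeatFluxVarianceDecay (9531/9532), the cheapest equilibrium rungs (9532 is the β² term of
#5's pressure for the heat-flux harmonic);
KineticCurrentsWindowLDUniform (14662), pointwise rung of #3; GossipConsumptionGlue (16766, OFLC →
#3, the ENGINE CONTRACT); DiluteSelfConsistency
(shared 3091). OVER CAP knowingly (8 crux-kind open + records; a tenure seat may fold #4 #5 #7 #8
under ClampedTransferDock by --split with
glue-by the v16 composition once it lands — same statements, same cone).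

TWO-LAYER PLAN. Dock layer: ClampedTransferDock ⇐ {#7, #5, #4, #8} by the heart's v16 composition
(SIGNED cubic channel: hi = (b·w)(|w|² − 5θ − G)
split as F_b + top, F_b = (b·w)G_b with G_b = Rχ_{K₁²} − ρ·ω₀(·/θ), ρ restoring ∫|w|²G_b M_θ = 0 — a
Gaussian tail O(K₁⁴e^{−K₁²/2Θ̄}) because the
un-truncated remainder has zero momentum projection by the ledger's own choice of G; two-sided
entropy inequality ±β on F_b gives
E_true|Σ w̄F_b| ≤ (C_BK₁/β₀)(KL + log 2 + ε(N+1)) — the shape `w·(B K₁)·KL + w(N+1)ε` the landed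
rate window clause consumes — and the top
|w| > K₁ plus ρ·ω₀ are paid in L¹ by SEET at every rate c; order of constants δ → K⋆ → V → β₀ → c →
K₁ → ε's → τ₀ → N₀). The pre-rev-35
FALLBACK (heart variant with the true-law coherence child (ii) CSCV-W) is DEMOTED: the heart lead's
wave found CSCV-W question-begging
(CSCV-W ⇐ BoundedOddWindowLLN ∧ ECT, p140531); it stays typed in Theorems.HydroLimitInBandOfHeart,
not an item. By ENGINE: #5 (hence #3) ⇐
OneFlightLayeredChaos via the gossip-forecast ledger of the 14662 line (chain rule + fibrewise
entropy inequality; B1′ enters multiplicatively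
in the one-kick oscillation bound, whose constants depend on F only through its growth constant —
which is why the class-uniform β₀ costs the
engine nothing extra) made uniform along families; the odd members (signed band current, heat-flux
harmonic: KacPairHeatFlux's 2/3 contraction)
are the easy half. Collisional channel: #4 ⇐ Localisation (C′ = ClampedTransferWindowLD along
compact families of constants) + the four
equilibrium LD cores of CompositionC3 / RadialVirialAssembly, missing dynamical facts F1/F2 — lemmas
with --supports, never items. Tails: #7
known at s = 0 and under HighMomentumCutoff (landed Seet.lean); #6/#8 under the REFERENCE law are
e^{−c(τ/σ)³}-small — the content is
propagation under the true pre-shock law.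

KILL CRITERIA. ¬KineticCurrentsLDAlongFamilies at global Gibbs for the shear functional
(equivalently TwoClocks' ¬EquilibriumShearWindowLD
14446, or a witness against the variance rung 9531) closes this route and TwoClocks outright, and
kills #5 a fortiori. ¬#5 with #3 standing
(a normalised class sequence defeating any common tilt) ⇒ restate #5 to the BAND-ONLY uniform
instance (ideator k2's
`BandRemainderLDAlongFamilies`: b normalised, R continuous, supported in K⋆² < s′ < (K₁+1)², ∫|w|²R
M_θ = 0, tilt |β|·K₁ ≤ β₀) which is all
DOCK-Q consumes. ¬OneFlightLayeredChaos kills the MECHANISM but not the docking node, which then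
belongs to TwoClocks / the entropy routes.
¬#4: a relay or cage beating the TRANSFER clamp in some row (refuted-substantive) breaks the
collisional node of this route, TwoClocks (16623)
and the in-band line ⇒ pre-committed pivot: per-particle collision-COUNT truncation with an
in-probability remainder, or the polynomial-moment
(Chebyshev/√-Grönwall) currency. ¬#7 (a pre-shock true-law family with a merely exponential cubic
tail; NB the Gaussian-rate strengthening IS
false, the exponential family is the weakest super-exponential class) ⇒ the cubic channel loses its
rate: fall back to a fixed-K₁ channel with
the true-law coherence/LLN child re-filed (BoundedOddWindowLLN-type), or to UGibbsSRBRigidity's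
guarded GaussianTails 14415 (landed
seet_of_gaussianTails) as a conditional bridge. ¬#8 alone ⇒ a different price of the clamp's energy
half (TwoClocks' TransferActivityTails
16624 ⟹ #6 ∧ #8, landed). #11 is refutable only by ¬HydrodynamicLimit-strength witnesses against its
antecedents' conjunction (DockShape).
Recorded negative edges now FOUR: 14116 (unclamped collisional LD, platoons), TwoClocks' 14441
(capped, dense blob), 13733 (momentum-clamped,
Newton-cradle energy relay), 17700 (fixed-tilt coherence functional with linear soft-mode response,
Galilean boost) — nothing unclamped /
capped / momentum-only-clamped, and no un-shifted band or shell truncation of a Galilean-orthogonal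
current exponentiated at a fixed tilt with a
vanishing threshold, may be re-wanted; #3/#5 carry the three orthogonality rows, #4 the transfer
clamp + centrings, #6–#8 are L¹ tails.

NOT DECOMPOSED YET. The dock's split stays flat (#4 #5 #7 #8 + #11); folding it under
ClampedTransferDock (--split … --glue-by <v16
composition>) is a tenure move once DOCK-Q is proved, changing no statement. Below the cruxes,
deliberately lemmas-not-items: the four v16
stubs of the heart (workers/lead of crux 9133 land them as Theorems; DOCK-Q's prover imports them),
the Localisation lemma and F1/F2 under #4,
the four equilibrium LD cores, SEET ⇒ ECT (landed). GUARD-RELATIVISED TAILS (tenure option, not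
filed): #6, #7, #8 quantify over ALL classical
solutions on [0,T); the dock needs them only along guarded solutions — if a refuter kills one
through an imploding or jamming solution, restate
to the guarded form. Also open, NOT filed: the band-only instance BandRemainderLDAlongFamilies
(restate target of #5, see KILL CRITERIA), the
Mazur-shifted variant with explicit response g₁ (ideator k1 `BandCurrentLDQuantTilt`, same content),
the m-layer version of OneFlightLayeredChaos,
the family-uniform upgrade of the 14662 line's skeleton, the d = 2 bench.
Deliberately NOT re-filed: any small-tilt-after-ε form of BCL (useless in the Grönwall), any
|v|²-orthogonalised-weight variant of BCL (a zombie: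
still false by tagged-particle mixing but not cheaply refutable — ideator k2 §3), the coherence
architecture in the empirical mesoscopic frame
(R4), the profile-wise or pointwise docks, the DSC-carrying dock,
RelEntropyVanishing/RelEntropyToLimit.

CHEAPEST FALSIFIER. Of the repair (Lean, cheap): (i) `example : KineticCurrentsLDAlongFamiliesQ ↔
HydroLimitInBandSignedBand.KineticCurrentsLDAlongFamiliesQ
:= Iff.rfl` and `KineticCurrentsLDAlongFamiliesQ → KineticCurrentsLDAlongFamilies := kcwf_of_kcwfQ`
(planner Sketch.lean rc 0, 2026-08-17T07:5xZ) —
if either breaks, #5 is mis-typed; (ii) the boost test ON #5's TEXT: for a normalised class member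
(C = 1) compute sup_D [β₀·E_{M_{θ,De}}F − D²/2θ]
— must be ≤ 0 for β₀ ≲ θ/4 by Gaussian smoothing (a refuter's 20-line quadrature; a positive value
refutes #5 exactly as 17700 died); (iii) land
the heart's BandShiftStatics (static, S/M-sized) — if the re-orthogonalisation defect is not a
Gaussian tail the signed channel is mis-designed
and #11 is vacuous-hard. Of the bets: #7 at global Gibbs is stationarity (sanity), at s = 0 Gaussian
(proved) — first real test a planar
compression wave; #5's cheapest rung is the equilibrium heat-flux variance decay 9532 (β² term) — an
N-uniform τ-floor there kills #5 and #3.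
Mechanism (kit, when allowed): event-driven MD of EQUILIBRIUM hard spheres, N ∈ {10⁴,10⁵}, σ³ ∈
{0.01,0.05,0.1} — impact-parameter histogram
given the exact vs r-coarse pre-flight environment (#2), (N+1)·E[Ȳ_τ²] for the shear stress and for
the signed band current (b·w)Rχ vs τ ∈ [1,64]
(rungs 9531/9532, #5), cubic tail rate and transfer-activity tails behind a planar compression wave
(#7, #6, #8). Lookup (2026-08-15/16/17): no N-uniform
Cesàro decay of equilibrium stress/heat-flux autocorrelations at FIXED density in print (nearest
BGSSCPAM2023, vBLLS 1980 doi:10.1007/bf01008050 — Boltzmann–Grad).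

NUMBERS. ℓ/ε = 1/(√2πσ³): 22.5 at σ³ = 0.01, 4.5 at 0.05, 2.25 at 0.1; per-flight expansion 1 +
2L/ε; P(no shadow) = e^{−4L/3ℓ} ≈ 0.26 at L = ℓ.
Gossip contraction per fresh collision: stress 1/2, heat flux 2/3. Boost witness against
17700 (record): a = θ = Θ̄ = 1, u = 0, σ = min(1/4, η₀), R(s′) = (s′−k²)1{k²<s′≤K²}, K = M + 3 (M =
E(1+‖ξ‖)⁶), k = 1/K, η = 1/(4K(1+M)),
ε = 1/(40K²); floor (N+1)⁻¹log E e^{λS} ≥ 5/(96K²) > ε at D = 1/K, every τ, N; generic shape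
sup_D(λ·5D − D²/2) = 12.5λ². Signed channel: band
member growth C_B·K₁, tilt β₀/(C_B K₁), Grönwall factor e^{C K₁ t/β₀} against SEET's e^{−cK₁} with c
> C t/β₀; re-orthogonalisation defect
O(K₁⁴e^{−K₁²/2Θ̄}). Cradle witness against 13733 (record): transfer activity ≥ (σ/τ)V_p²/2 per
relay, clamped out by #4. Items after rev 35:
22 records in the file — crux-kind OPEN: OneFlightLayeredChaos 2, KCWF 3, LCT 4, KCWF-Q 5, CAT 6,
SEET 7, EAT 8, DOCK-Q 11; supports as
listed; refuted/replaced records 13733, 17700, 17733; `closes` has 7 binders, open content 5 leaves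
+ 1 plumbing glue.

DEFINITION REQUESTS. None: HardSphereCollisionRecord, rhoLim/profileOf (HardSphereEulerLLN),
hsCompressibility, localMaxwellian / localGibbsLaw
and Torus.IsSmoothSpaceTimeOn / Torus.partialDeriv type everything (Sketch.lean rc 0 with the
route's own imports).

Novelty: Searches (2026-08-15): `lit search --source crossref` ×8 ("randomized gossip algorithms Boyd Ghosh
Prabhakar Shah" → doi:10.1109/tit.2006.874516; "products of stochastic matrices averaging" →
doi:10.1007/978-3-642-28003-0_2; "Maxwell molecules moments relaxation heat flux Ikenberry
Truesdell" → doi:10.1512/iumj.1956.5.55001, doi:10.1063/1.1706082; "stress autocorrelation hard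
sphere gas low density rigorous" → doi:10.1002/cpa.22120 = BGSSCPAM2023, Eder 1977, Résibois 1975;
"Chernov Dolgopyat standard pairs many particle" → doi:10.4171/022-2/80,
doi:10.1007/s00220-011-1342-6; "energy transfer billiard gas Dolgopyat Liverani" →
doi:10.1007/s00220-011-1317-7; "Enskog collision statistics empirical Pulvirenti Simonella" →
doi:10.1007/s00222-016-0682-4, doi:10.1142/s0218202515500256; "molecular chaos impact parameter
shadowing third particle" → nothing relevant); `lit frontier AtomisticToContinuum --since 2021` (30
rows: CanestrariLiveraniOlla2026, DHM follow-ups, binary-collision-model fluctuations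
doi:10.1007/s10955-026-03570-w — none on standard pairs for gases); `lit bridges
AtomisticToContinuum --cross any` (30 rows, survey doi:10.1090/bull/1650 only); `lit galaxy search
"standard pairs hard spheres gas equidistribution impact parameter" --star all` (0 rows; crabby
queue timed out); local `lit search`/OpenAlex unavailable this session (searchd reset / 429).
Ledger: route files of the sub read before and after the D-0027 audit (72 files, most retired
`not-a-thesis`; none uses  [refs: 10.1109/tit.2006.874516, 10.1007/978-3-642-28003-0_2, 10.1512/iumj.1956.5.55001, 10.1063/1.1706082, 10.1002/cpa.22120, 10.4171/022-2/80, 10.1007/s00220-011-1342-6, 10.1007/s00220-011-1317-7, 10.1007/s00222-016-0682-4, 10.1142/s0218202515500256, 10.1007/s10955-026-03570-w, 10.1090/bull/1650, 10.1090/memo/0927, 10.1007/s00023-007-0351-7, 10.1007/bf02392695, 10.1137/070695423, doi:10.1109/tit.2006.87]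

Barriers (technique_class: standard-pairs hyperbolic-coupling kac-walk gossip): - technique_class: standard-pairs hyperbolic-coupling kac-walk gossip
- Literature.Barriers.AtomisticToContinuum.BoltzmannHypothesisBarrier: evaded in form — no
classification of stationary states of the infinite system is attempted; the engine proves
finite-window decorrelation / window LD from explicit (local) Gibbs data, uniformly in N, and the
barrier's ideal-gas kernel is respected exactly (no collisions ⇒ averaging matrices are the identity
⇒ no gossip decay; the shear rung 9531 is false for free flight, as it must be).
- Literature.Barriers.AtomisticToContinuum.MacroErgodicityBarrier: the FouriersLaw-side sibling
(regular stationary states of chains); not met — Euler scale, finite windows, no sector condition;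
the bet is that conditional MEANS over kinetic windows (gossip) replace ergodic decompositions.
- Literature.Barriers.AtomisticToContinuum.HighMomentumCutoffBarrier: touches the heat-flux part of
the docking node (cubic growth, truncated by G) and the dock; not evaded — it is carried as explicit
true-law TAIL cruxes (rev 32): SuperExponentialEnergyTails (17701, the rate form of the cubic tails
ECT 9235; the barrier's lintegral_exp_cubic_eq_top is exactly why entropy alone cannot give it),
CollisionActivityTails (13734) and EnergyActivityTails (17703) for contact functionals; the
reference-law LDs (16659, 17691, 17700) are small-tilt with Gaussian references;
OneFlightLayeredChaos is EASIER for fast particles (long flights in units of ε).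
- Literature.Barriers.Ato

Novelty grade: new-combination — PROVISIONAL (refuter rreview-0815T13-30-g3-0, route review, 10th pass; searchd rc75 all session — a novelty-audit with searchd up should confirm via lit search/rank). NEW-COMBINATION = (1) standard pairs / coupling for singular hyperbolic billiards (Chernov–Dolgopyat 2009 Mem. AMS 198, two-body/one  (refuter refuter-rreview-0815T13-30-g3-0, 2026-08-15T18:27:18Z; prior: ChernovDolgopyat2009, doi:10.4171/022-2/80, Chernov-Zhang 2009 (coupling lemma, singular hyperbolic systems), doi:10.1007/bf02392695, doi:10.1109/tit.2006.874516, doi:10.1512/iumj.1956.5.55001, BGSSCPAM2023 (doi:10.1002/cpa.22120), doi:10.1007/s10955-016-1598-5, OllaVaradhanYau1993, BalintToth2008)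

History (route lifecycle, newest last):
- 2026-08-16T20:36:54Z · rev 21: restated ClampedCurrentsDock (stmt-AtomisticToContinuum-14680) — route-repair rfix-1022be7d step 2b/4 (rev 21): RESTATE the vacuous old dock 14680 (KCWU → 13733[refuted] → CAT → ECT → DSC → HL) as ClampedTransferDock := CAT → (planner-rfix-AtomisticToContinuum-OneFlightG-1022be7d-0)
- 2026-08-16T20:38:33Z · rev 22: restated EquilibriumClampedCollisionalWindowLD (stmt-AtomisticToContinuum-13733 refuted) — route-repair rfix-1022be7d step 2c/4 (rev 22): RESTATE the Lean-refuted 13733 EquilibriumClampedCollisionalWindowLD (momentum clamp; refuted-misstated by the Ne (planner-rfix-AtomisticToContinuum-OneFlightG-1022be7d-0)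
- 2026-08-16T20:38:33Z · REPAIRED (restate EquilibriumClampedCollisionalWindowLD) — back to open: route-repair rfix-1022be7d step 2c/4 (rev 22): RESTATE the Lean-refuted 13733 EquilibriumClampedCollisionalWindowLD (momentum clamp; refuted-misstated by the Ne (planner-rfix-AtomisticToContinuum-OneFlightG-1022be7d-0)
- 2026-08-16T20:44:55Z · rev 25: restated ClampedTransferDock (stmt-AtomisticToContinuum-16657), Assembly (stmt-AtomisticToContinuum-14647) — route-repair rfix-1022be7d step 4b (rev 25, final shape): RESTATE ClampedTransferDock := KineticCurrentsLDAlongFamilies → CAT → ECT → DSC → HL (the docking node (planner-rfix-AtomisticToContinuum-OneFlightG-1022be7d-0)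
- 2026-08-16T20:47:44Z · rev 26: dropped EquilibriumClampedTransferWindowLD — route-repair rfix-1022be7d step 5a: DROP the equilibrium rung EquilibriumClampedTransferWindowLD (stmt-16623) from THIS route only — it stays TwoClocks' crux 3 (planner-rfix-AtomisticToContinuum-OneFlightG-1022be7d-0)
- 2026-08-16T23:23:53Z · rev 29: restated ClampedTransferDock (stmt-AtomisticToContinuum-16665), Assembly (stmt-AtomisticToContinuum-16666) — route-repair rrepair-07645bdd (statement re-type D-0032, p126922), rev 29 step 1/2: the packing guard is now a HYPOTHESIS of the conjunct, so DiluteSelfConsiste (planner-rrepair-AtomisticToContinuum-OneFlight-07645bdd-0)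
- 2026-08-17T06:47:02Z · BROKEN — BandCoherenceLDAlongFamilies (stmt-AtomisticToContinuum-17700, crux) refuted by Summit.AtomisticToContinuum.HydrodynamicLimit.Theorems.OneFlightGossipEngineBandCoherenceLDAlongFamilies_refuted @ d302ca5584d5 (refuter-rattack-stmt-AtomisticToContinuum-17700-0)
- 2026-08-20T06:49:33Z · CLOSED refuted — refuted:stmt-AtomisticToContinuum-17700 (BandCoherenceLDAlongFamilies) by Summit.AtomisticToContinuum.HydrodynamicLimit.Theorems.OneFlightGossipEngineBandCoherenceLDAlongFamilies_refuted (grace expired, auto-close) (gate)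

sub-problem: HydrodynamicLimit · status: closed(refuted) · opened planner-plancard-AtomisticToContinuum-Hydrody-061c62f0-0 2026-08-15T13:59:59Z · rev 39 · ledger route-AtomisticToContinuum-OneFlightGossipEngine
GENERATED by the gate from the ledger (D-0016/17). Provers cite these decls: `theorem foo : Summit.AtomisticToContinuum.HydrodynamicLimit.Theses.OneFlightGossipEngine.<Decl> := …` in Summits/AtomisticToContinuum/HydrodynamicLimit/Theorems/<Name>.lean.
-/

namespace Summit.AtomisticToContinuum.HydrodynamicLimit.Theses.OneFlightGossipEngine

open scoped BigOperators Topology Manifold Classical MeasureTheory ProbabilityTheory Matrix InnerProductSpace ComplexConjugate ContinuousMap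
open Filter Set Function TopologicalSpace MeasureTheory

attribute [summit_statement] _root_.HydrodynamicLimit

-- earlier OneFlightLayeredChaos (stmt-AtomisticToContinuum-9688, replaced 2026-08-16T03:43:26Z -> stmt-AtomisticToContinuum-14535): retired by None — [crux] ONE-FLIGHT LAYERED ANGULAR CHAOS (card one-flight-standard-pairs-kac B1, corrected for shadowing). Setting: N+1 spheres of diameter ε = hsDiameter σ N on 𝕋³, law = local Gibbs (first case: global Gibbs, constant a₀, u₀ = 0, θ₀), 0 < σ < σ₀; mean
/-- item stmt-AtomisticToContinuum-14535 · crux · rank 2 · closed · moot by None · by planner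
why it might fail: Needs N-uniform log-Lipschitz regularity at scale ε of flight-start position laws given cells + EXACT velocities of all particles; in print only two-body (Chernov–Dolgopyat) or one 3-D particle (Bálint–Tóth); recollision chains or dense clusters may pin impact parameters on events of mass ≫ σ^p.
sources: ChernovDolgopyat2009, doi:10.4171/022-2/80, BalintToth2008, MarklofStrombergsson2011, doi:10.1007/s10955-016-1598-5, BGSSCPAM2023
[crux] ONE-FLIGHT ANGULAR CHAOS, PER COLLISION, GIVEN THE KINETIC-SCALE COARSE PAST — REPAIRED C′
(route-repair 2026-08-16 after refuter rattack-9688-0's refuted-misstated verdict on the informal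
B1′; evidence CRUX-ATTACK-9688.md, ms_kernel_check.{py,out}, B1prime-precision.md). WHAT WAS WRONG:
(M1) "uniformly in N" included bounded N, where two spheres on 𝕋³ are the Z³-periodic Lorentz gas
and the Marklof–Strömbergsson Boltzmann–Grad kernel makes the next impact parameter non-uniform
given the past (d=3: K(0|0) ≥ ζ(3)⁻¹(1−3/(2π)) = 0.4347 > 1/π) ⇒ liminf_{σ→0} defect > 0 at N = 1;
(M2) the joint form "TV ≤ δ_k·#collisions" holds trivially with δ_k = 1/n_k at large N. REPAIR
(typed over HardSphereCollisionRecord.lean, no new definitions; global Gibbs = the old text's "first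
case": constant a₀, u₀ = 0, θ₀; λ^N = localGibbsLaw σ a₀ 0 θ₀ N Φ_N; ε_N = σ(N+1)^{-1/3}, ℓ_N =
(N+1)^{-1/3}/(√2πσ²)): ∀ a₀,θ₀ > 0 ∃ C,p > 0 ∃ σ₀ ∀ σ ∈ (0,σ₀) ∃ ρ ∈ [σ, (√2πσ²)⁻¹] (cells r_N =
ρ(N+1)^{-1/3}, ε_N ≤ r_N ≤ ℓ_N) ∀ τ > 0 ∀ n ∃ N₀(σ,ρ,τ,n) ∀ N ≥ N₀ ∀ Φ_N ∀ i ∀ measurable B ⊆ ℝ³ ∀ E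
∈ 𝒢 := σ(coarsePastOf Φ_N (coarseCell r_N) i n, nthPartnerOf Φ_N i n) [r_N-cells of ALL positions +
exact velocities of A -/
@[route_item "route-AtomisticToContinuum-OneFlightGossipEngine", crux]
def OneFlightLayeredChaos : Prop :=
  ∀ (a₀ θ₀ : ℝ), 0 < a₀ → 0 < θ₀ → ∃ C : ℝ, 0 < C ∧ ∃ p : ℝ, 0 < p ∧ ∃ σ₀ : ℝ, 0 < σ₀ ∧ ∀ σ : ℝ, 0 < σ → σ < σ₀ → ∃ ρ : ℝ, σ ≤ ρ ∧ ρ * (Real.sqrt 2 * Real.pi * σ ^ 2) ≤ 1 ∧ ∀ τ : ℝ, 0 < τ → ∀ n : ℕ, ∃ N₀ : ℕ, ∀ N : ℕ, N₀ ≤ N → ∀ Φ : Literature.Analysis.FluidPDE.HardSphereFlow (Literature.Analysis.FluidPDE.Torus.geometry (Fin 3)) (Literature.MathematicalPhysics.KineticTheory.hsDiameter σ N) (N + 1), ∀ (i : Fin (N + 1)) (B : Set Literature.MathematicalPhysics.KineticTheory.V3), MeasurableSet B → let G : Literature.Analysis.FluidPDE.Geometry (Fin 3) Literature.MathematicalPhysics.KineticTheory.T3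 := Literature.Analysis.FluidPDE.Torus.geometry (Fin 3); let ε : ℝ := Literature.MathematicalPhysics.KineticTheory.hsDiameter σ N; let w : ℝ := τ * ((N + 1 : ℕ) : ℝ) ^ (-(1 / 3 : ℝ)); let q : Literature.MathematicalPhysics.KineticTheory.T3 → (Fin 3 → ℤ) := Literature.Analysis.FluidPDE.Torus.coarseCell (ρ * ((N + 1 : ℕ) : ℝ) ^ (-(1 / 3 : ℝ))); let P : MeasureTheory.Measure (Literature.Analysis.FluidPDE.Config (N + 1) (Fin 3) Literature.MathematicalPhysics.KineticTheory.T3) := Literature.MathematicalPhysics.KineticTheory.localGibbsLaw σ (fun _ => a₀) (fun _ => 0) (fun _ => θ₀) N Φ; let W : Set (Literature.Analysis.FluidPDE.Config (N + 1) (Fin 3) Literature.MathematicalPhysics.KineticTheory.T3) := {z | n + 1 ≤ Set.ncard (Literature.Analysis.FluidPDE.collisionTimesOf G ε (fun t => Φ.flow t z) i ∩ Set.Ioc 0 w)}; let A : Set (Literature.Analysis.FluidPDE.Config (N + 1) (Fin 3) Literature.MathematicalPhysics.KineticTheory.T3) := {z | (Φ.nthRecordOf i n z).outDir ∈ B}; let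 u : ℝ := (((Literature.MathematicalPhysics.KineticTheory.sphereMeasure (E := Literature.MathematicalPhysics.KineticTheory.V3)) Set.univ)⁻¹ * (Literature.MathematicalPhysics.KineticTheory.sphereMeasure (E := Literature.MathematicalPhysics.KineticTheory.V3)) {ω | (ω : Literature.MathematicalPhysics.KineticTheory.V3) ∈ B}).toReal; ∀ E : Set (Literature.Analysis.FluidPDE.Config (N + 1) (Fin 3) Literature.MathematicalPhysics.KineticTheory.T3), MeasurableSet[MeasurableSpace.comap (fun z => (Φ.coarsePastOf q i n z, Φ.nthPartnerOf i n z)) inferInstance] E → |(P (W ∩ A ∩ E)).toReal - u * (P (W ∩ E)).toReal| ≤ C * σ ^ p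

/-- item stmt-AtomisticToContinuum-16659 · crux · rank 3 · closed · moot by None · by planner
why it might fail: All scaled cumulants of the window average must vanish at scale N with thresholds UNIFORM along profile families; ring-induced heavy tails of the kick martingale at LD scale; the η₀ activity-ratio guard may miss a local packing threshold; no print at fixed density, open even at global Gibbs.
sources: OllaVaradhanYau1993, KipnisLandim1999, Varadhan1993EntropyMethods, BGSSCPAM2023, BGSSAnnals2023, doi:10.1109/tit.2006.874516
[crux] THE DOCKING NODE (binder of `closes`; antecedent of the dock) = KCWU (stmt-14662) ALONG
FAMILIES (`KineticCurrentsWindowLDFamily` of the dock line, byte-identical — Iff.rfl — with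
Cruxes/ClampedCurrentsDock/Lines/IdeatorTwoSketch.lean §1,
Theorems/OneFlightGossipEngineClampedCurrentsDockKineticInstance and the in-band twin
Theorems/ImplosionDichotomyHydroLimitInBandOfHeart): ∃η₀ > 0 ∀t₁ ∀ one-parameter FAMILIES s ↦ (a_s,
θ_s, u_s) of profiles, jointly continuous in (s,x), positive, with the packing guard σ³·sup_x a_s ≤
η₀∫a_s for every s ∈ [0,t₁] ∀σ > 0 ∀ flow families Φ_N ∀ families of weights (A_s, b_s, G_s) jointly
continuous, with F_s(x,v) = Σ_jk A_s,jk(x) w_j w_k + (b_s(x)·w) G_s(x,|w|²), w = v − u_s(x), |F_s| ≤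
C(1+|v|²) uniformly in s, F_s ⊥ 1, v_j, |v|² under M_(1,u_s(x),θ_s(x)) at every x and s: ∃β₀ > 0
∀|β| ≤ β₀ ∀ε > 0 ∃τ₀ ∀τ ≥ τ₀ ∃N₀ ∀N ≥ N₀ ∀s ∈ [0,t₁]: ∫ exp(β Σ_i w_N⁻¹ ∫₀^{w_N} F_s(x_i(r), v_i(r))
dr) dλ^N_s ≤ exp(ε(N+1)), w_N = τ(N+1)^(-1/3), λ^N_s = localGibbsLaw σ a_s u_s θ_s N Φ_N —
thresholds UNIFORM along the family (s innermost), window quantifier ∃τ₀ ∀τ ≥ τ₀. WHY THIS TYPING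
(finding UNIFORMITY, leads 14680-c1/c2 and 9133-c2; refuter ATTACK (a) on 14680 -/
@[route_item "route-AtomisticToContinuum-OneFlightGossipEngine", crux]
def KineticCurrentsLDAlongFamilies : Prop :=
  ∃ η₀ : ℝ, 0 < η₀ ∧ ∀ (t₁ : ℝ) (a θ₀ : ℝ → Literature.MathematicalPhysics.KineticTheory.T3 → ℝ) (u₀ : ℝ → Literature.MathematicalPhysics.KineticTheory.T3 → Literature.MathematicalPhysics.KineticTheory.V3), Continuous (Function.uncurry a) → Continuous (Function.uncurry θ₀) → Continuous (Function.uncurry u₀) → (∀ s x, 0 < a s x) → (∀ s x, 0 < θ₀ s x) → ∀ σ : ℝ, 0 < σ → (∀ s ∈ Set.Icc 0 t₁, σ ^ 3 * (⨆ x, a s x) ≤ η₀ * ∫ x, a s x) → ∀ Φ : (N : ℕ) → Literature.Analysis.FluidPDE.HardSphereFlow (Literature.Analysis.FluidPDE.Torus.geometry (Fin 3)) (Literature.MathematicalPhysics.KineticTheory.hsDiameter σ N) (N + 1), ∀ (A : ℝ → Literature.MathematicalPhysics.KineticTheory.T3 → Fin 3 → Fin 3 → ℝ) (b : ℝ → Literature.MathematicalPhysics.KineticTheory.T3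 → Literature.MathematicalPhysics.KineticTheory.V3) (G : ℝ → Literature.MathematicalPhysics.KineticTheory.T3 × ℝ → ℝ), Continuous (Function.uncurry A) → Continuous (Function.uncurry b) → Continuous (Function.uncurry G) → (let F := fun (s : ℝ) (y : Literature.MathematicalPhysics.KineticTheory.T3 × Literature.MathematicalPhysics.KineticTheory.V3) => (∑ j : Fin 3, ∑ k : Fin 3, A s y.1 j k * ((y.2 - u₀ s y.1) j * (y.2 - u₀ s y.1) k)) + (∑ j : Fin 3, b s y.1 j * (y.2 - u₀ s y.1) j) * G s (y.1, ‖y.2 - u₀ s y.1‖ ^ 2); (∃ C : ℝ, ∀ s ∈ Set.Icc 0 t₁, ∀ y : Literature.MathematicalPhysics.KineticTheory.T3 × Literature.MathematicalPhysics.KineticTheory.V3, |F s y| ≤ C * (1 + ‖y.2‖ ^ 2)) → (∀ s ∈ Set.Icc 0 t₁, ∀ x, ∫ v, F s (x, v) * Literature.Analysis.FluidPDE.localMaxwellian 1 (θ₀ s x) (u₀ s x) v = 0) → (∀ s ∈ Set.Icc 0 t₁, ∀ x (j : Fin 3), ∫ v, F s (x, v) * v j * Literature.Analysis.FluidPDE.localMaxwellian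 1 (θ₀ s x) (u₀ s x) v = 0) → (∀ s ∈ Set.Icc 0 t₁, ∀ x, ∫ v, F s (x, v) * ‖v‖ ^ 2 * Literature.Analysis.FluidPDE.localMaxwellian 1 (θ₀ s x) (u₀ s x) v = 0) → ∃ β₀ : ℝ, 0 < β₀ ∧ ∀ β : ℝ, |β| ≤ β₀ → ∀ ε : ℝ, 0 < ε → ∃ τ₀ : ℝ, 0 < τ₀ ∧ ∀ τ : ℝ, τ₀ ≤ τ → ∃ N₀ : ℕ, ∀ N : ℕ, N₀ ≤ N → ∀ s ∈ Set.Icc 0 t₁, ∫⁻ z, ENNReal.ofReal (Real.exp (β * ∑ i : Fin (N + 1), (τ * ((N : ℝ) + 1) ^ (-(1 / 3 : ℝ)))⁻¹ * ∫ r in (0 : ℝ)..(τ * ((N : ℝ) + 1) ^ (-(1 / 3 : ℝ))), F s ((Φ N).flow r z i))) ∂(Literature.MathematicalPhysics.KineticTheory.localGibbsLaw σ (a s) (u₀ s) (θ₀ s) N (Φ N)) ≤ ENNReal.ofReal (Real.exp (ε * ((N : ℝ) + 1))))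

/-- item stmt-AtomisticToContinuum-17691 · crux · rank 4 · closed · moot by None · by planner
why it might fail: No N-uniform exp-moment control of clamped collisional currents beyond Lanford's time at fixed σ³ (F1); the clamp-deficit static residual needs a tagged transfer-activity LLN (F2); a relay/cage passing the TRANSFER clamp in one row, or EOS missing the static response near η₀, refutes it.
sources: OllaVaradhanYau1993, Spohn1991, SalsburgWood1962, Serre2021, Yau1991, Summit.AtomisticToContinuum.HydrodynamicLimit.Theorems.OneFlightGossipEngineEquilibriumClampedCollisionalWindowLD_refuted
[crux] THE REPAIRED COLLISIONAL NODE — LOCAL TRANSFER-CLAMPED COLLISIONAL WINDOW LD ALONG FAMILIES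
(child (iii) of the dock filed by the glued split; byte-identical (Iff.rfl) with the heart's
Theorems.HydroLimitInBandOfHeart.LocalClampedTransferWindowLDFamily and the registered stub
`stub_localClampedTransferLD`). ∃η₀ ∀t₁ ∀ jointly continuous positive profile families (a_s, θ_s,
u_s) ∀σ∈(0,1/2) with σ³·sup a_s ≤ η₀∫a_s on [0,t₁] ∀ flow families Φ ∀ test families φ smooth on
[0,t₁]×𝕋³ ∃V₀ ∀V≥V₀ ∃β₀ ∀|β|≤β₀ ∀ε>0 ∃τ₀ ∀τ≥τ₀ ∃N₀ ∀N≥N₀ ∀s∈[0,t₁]: the three momentum rows X^m_k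
and the energy row X^e of the window collisional transfer current tested against φ_s, CLAMPED per
collision by ω_iω_j with ω_i = 1{act_i ≤ V}, act_i = (σ/τ)Σ_{collisions of i in (0,w]}(‖Δv_i‖ +
|Δ‖v_i‖²|/2) the TRANSFER activity, minus the EOS projections A^m_k, A^e with x-dependent
coefficients Z(ρ₀σ³), Z′(ρ₀σ³), ρ₀ = rhoLim(profileOf a_s) σ, and the deterministic centrings,
satisfy ∫exp(β(w⁻¹X − w⁻¹A)) dλ^N_s ≤ e^{ε(N+1)}, w = τ(N+1)^{-1/3}, λ^N_s = localGibbsLaw σ a_s u_s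
θ_s N Φ_N (REFERENCE law). WHY THE REFUTED 13733 DOES NOT PROPAGATE HERE: the Newton-cradle
line-lattice relay of Theorems/OneFlightGossipEngin -/
@[route_item "route-AtomisticToContinuum-OneFlightGossipEngine", crux]
def LocalClampedTransferLDAlongFamilies : Prop :=
  ∃ η₀ : ℝ, 0 < η₀ ∧ ∀ (t₁ : ℝ) (a θ₀ : ℝ → Literature.MathematicalPhysics.KineticTheory.T3 → ℝ) (u₀ : ℝ → Literature.MathematicalPhysics.KineticTheory.T3 → Literature.MathematicalPhysics.KineticTheory.V3) (ha : ∀ s, Continuous (a s)), Continuous (Function.uncurry a) → Continuous (Function.uncurry θ₀) → Continuous (Function.uncurry u₀) → ∀ (ha0 : ∀ s x, 0 < a s x), (∀ s x, 0 < θ₀ s x) → ∀ σ : ℝ, 0 < σ → σ < 1 / 2 → (∀ s ∈ Set.Icc 0 t₁, σ ^ 3 * (⨆ x, a s x) ≤ η₀ * ∫ x, a s x) → ∀ Φ : (N : ℕ) → Literature.Analysis.FluidPDE.HardSphereFlow (Literature.Analysis.FluidPDE.Torus.geometry (Fin 3)) (Literature.MathematicalPhysics.KineticTheory.hsDiameter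 σ N) (N + 1), ∀ φ : ℝ → Literature.MathematicalPhysics.KineticTheory.T3 → ℝ, Literature.Analysis.FunctionSpaces.Torus.IsSmoothSpaceTimeOn (Set.Icc 0 t₁) φ → ∃ V₀ : ℝ, 0 < V₀ ∧ ∀ V : ℝ, V₀ ≤ V → ∃ β₀ : ℝ, 0 < β₀ ∧ ∀ β : ℝ, |β| ≤ β₀ → ∀ ε : ℝ, 0 < ε → ∃ τ₀ : ℝ, 0 < τ₀ ∧ ∀ τ : ℝ, τ₀ ≤ τ → ∃ N₀ : ℕ, ∀ N : ℕ, N₀ ≤ N → ∀ s ∈ Set.Icc 0 t₁, (let ρ₀ : Literature.MathematicalPhysics.KineticTheory.T3 → ℝ := Literature.MathematicalPhysics.KineticTheory.rhoLim (Literature.MathematicalPhysics.KineticTheory.profileOf (a s) (ha s) (ha0 s)) σ; let w : ℝ := τ * ((N : ℝ) + 1) ^ (-(1 / 3 : ℝ)); let P := Literature.MathematicalPhysics.KineticTheory.localGibbsLaw σ (a s) (u₀ s) (θ₀ s) N (Φ N); let Z : Literature.MathematicalPhysics.KineticTheory.T3 → ℝ := fun x => Literature.MathematicalPhysics.KineticTheory.hsCompressibility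 (ρ₀ x * σ ^ 3); let Z' : Literature.MathematicalPhysics.KineticTheory.T3 → ℝ := fun x => deriv Literature.MathematicalPhysics.KineticTheory.hsCompressibility (ρ₀ x * σ ^ 3); let act := fun (i : Fin (N + 1)) z => σ / τ * (Φ N).collisionSum (Set.Ioc 0 w) (fun c => if c.fst = i then ‖c.postVel.1 - c.preVel.1‖ + |‖c.postVel.1‖ ^ 2 - ‖c.preVel.1‖ ^ 2| / 2 else 0) z; let ω := fun (i : Fin (N + 1)) z => if act i z ≤ V then (1 : ℝ) else 0; let Xm := fun (k : Fin 3) z => (Φ N).collisionSum (Set.Ioc 0 w) (fun c => ω c.fst z * ω c.snd z * ((φ s c.fstPos - φ s c.sndPos) * (c.postVel.1 k - c.preVel.1 k)) / 2) z; let Am := fun (k : Fin 3) z => (∫ r in (0 : ℝ)..w, ∑ i : Fin (N + 1), Literature.Analysis.FunctionSpaces.Torus.partialDeriv k (φ s) ((Φ N).flow r z i).1 * (θ₀ s ((Φ N).flow r z i).1 * (ρ₀ ((Φ N).flow r z i).1 * σ ^ 3) * Z' ((Φ N).flow r z i).1 + (1 / 3) * (Z ((Φ N).flow r z i).1 - 1)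 * ‖((Φ N).flow r z i).2 - u₀ s ((Φ N).flow r z i).1‖ ^ 2)) - w * ((N : ℝ) + 1) * ∫ x, ρ₀ x * Literature.Analysis.FunctionSpaces.Torus.partialDeriv k (φ s) x * (θ₀ s x * (ρ₀ x * σ ^ 3) * Z' x); let Xe := fun z => (Φ N).collisionSum (Set.Ioc 0 w) (fun c => ω c.fst z * ω c.snd z * ((φ s c.fstPos - φ s c.sndPos) * ((‖c.postVel.1‖ ^ 2 - ‖c.preVel.1‖ ^ 2) / 2)) / 2) z; let Ae := fun z => (∫ r in (0 : ℝ)..w, ∑ i : Fin (N + 1), ((∑ l : Fin 3, u₀ s ((Φ N).flow r z i).1 l * Literature.Analysis.FunctionSpaces.Torus.partialDeriv l (φ s) ((Φ N).flow r z i).1) * (θ₀ s ((Φ N).flow r z i).1 * (ρ₀ ((Φ N).flow r z i).1 * σ ^ 3) * Z' ((Φ N).flow r z i).1 + (1 / 3) * (Z ((Φ N).flow r z i).1 - 1) * ‖((Φ N).flow r z i).2 - u₀ s ((Φ N).flow r z i).1‖ ^ 2) + θ₀ s ((Φ N).flow r z i).1 * (Z ((Φ N).flow r z i).1 - 1) *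 (∑ l : Fin 3, Literature.Analysis.FunctionSpaces.Torus.partialDeriv l (φ s) ((Φ N).flow r z i).1 * (((Φ N).flow r z i).2 - u₀ s ((Φ N).flow r z i).1) l))) - w * ((N : ℝ) + 1) * ∫ x, ρ₀ x * (∑ l : Fin 3, u₀ s x l * Literature.Analysis.FunctionSpaces.Torus.partialDeriv l (φ s) x) * (θ₀ s x * (ρ₀ x * σ ^ 3) * Z' x); (∀ k : Fin 3, ∫⁻ z, ENNReal.ofReal (Real.exp (β * (w⁻¹ * Xm k z - w⁻¹ * Am k z))) ∂P ≤ ENNReal.ofReal (Real.exp (ε * ((N : ℝ) + 1)))) ∧ ∫⁻ z, ENNReal.ofReal (Real.exp (β * (w⁻¹ * Xe z - w⁻¹ * Ae z))) ∂P ≤ ENNReal.ofReal (Real.exp (ε * ((N : ℝ) + 1))))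

/-- item stmt-AtomisticToContinuum-17700 · crux · rank 5 · closed · refuted by Summit.AtomisticToContinuum.HydrodynamicLimit.Theorems.OneFlightGossipEngineBandCoherenceLDAlongFamilies_refuted @ d302ca5584d5 (refuter) · by planner
why it might fail: Scale-N LD under the reference law over τ→∞ free times: the tilt weighs a coherent band carrier by ~K₁²/(8Θ̄) ≫ 1, so co-moving clusters of band carriers (sub-extensive cost) must be o(N/K₁²) with LD probability; recollision chains could keep q̄ coherent; no print.
sources: OllaVaradhanYau1993, Yau1991, KipnisLandim1999, ChernovDolgopyat2009, BGSSCPAM2023, Varadhan1993EntropyMethods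
[crux] REFERENCE-LAW BAND-COHERENCE EXPONENTIAL MOMENT AT THE SMALL TILT (8Θ̄K₁)⁻¹, ALONG FAMILIES
(input of the dock ClampedTransferDock, filed top-level by the judge-repair 2026-08-17, line Sketch;
byte-identical (Iff.rfl) with the registered stub `stub_bandCoherenceLD` =
Theorems.ClampedTransferDockCubicRate.BandCoherenceLDFamily). ∃η₀ ∀t₁ ∀Θ̄ ∀ jointly continuous
positive families (a_s, θ_s ≤ Θ̄, u_s) with the packing guard σ³·sup a_s ≤ η₀∫a_s on [0,t₁] ∀σ>0 ∀
flow families Φ ∀ 0<K⋆≤K₁ ∀ measurable radial weights R with R(s,x,s′) = 0 for s′ ≤ K⋆² and |R| ≤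
|s′| ∀η>0 ∀ε>0 ∃τ₀ ∀τ≥τ₀ ∃N₀ ∀N≥N₀ ∀s∈[0,t₁]: ∫ exp((8Θ̄K₁)⁻¹ Σ_i 1{‖q̄_i‖ > η·cub_i}·cubBand_i)
dλ^N_s ≤ e^{ε(N+1)}, where over the window [0,w], w = τ(N+1)^{-1/3}: W_i(r) = v_i(r) − u_s(x_i(r)),
cub_i = w⁻¹∫₀^w ‖W_i‖³, cubBand_i = the same restricted to K⋆ < ‖W_i‖ ≤ K₁, q̄_i = w⁻¹∫₀^w
R(s,x_i,‖W_i‖²) W_i, and λ^N_s = localGibbsLaw σ a_s u_s θ_s N Φ_N is the REFERENCE (local Gibbs)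
law — not the true law. Pays the BAND (K⋆,K₁] of the coherent suprathermal content inside the
Grönwall by the entropy inequality w.r.t. the local reference at tilt (8Θ̄K₁)⁻¹ (landed
band_expectation p137576, stub_cubicChannelRate p138311). ENGINE- -/
@[route_item "route-AtomisticToContinuum-OneFlightGossipEngine"]
def BandCoherenceLDAlongFamilies : Prop :=
  ∃ η₀ : ℝ, 0 < η₀ ∧ ∀ (t₁ Θbar : ℝ) (a θ₀ : ℝ → Literature.MathematicalPhysics.KineticTheory.T3 → ℝ) (u₀ : ℝ → Literature.MathematicalPhysics.KineticTheory.T3 → Literature.MathematicalPhysics.KineticTheory.V3), Continuous (Function.uncurry a) → Continuous (Function.uncurry θ₀) → Continuous (Function.uncurry u₀) → (∀ s x, 0 < a s x) → (∀ s x, 0 < θ₀ s x) → (∀ s ∈ Set.Icc 0 t₁, ∀ x, θ₀ s x ≤ Θbar) → ∀ σ : ℝ, 0 < σ → (∀ s ∈ Set.Icc 0 t₁, σ ^ 3 * (⨆ x, a s x) ≤ η₀ * ∫ x, a s x) → ∀ Φ : (N : ℕ) → Literature.Analysis.FluidPDE.HardSphereFlow (Literature.Analysis.FluidPDE.Torus.geometry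 (Fin 3)) (Literature.MathematicalPhysics.KineticTheory.hsDiameter σ N) (N + 1), ∀ Kstar K₁ : ℝ, 0 < Kstar → Kstar ≤ K₁ → ∀ R : ℝ → Literature.MathematicalPhysics.KineticTheory.T3 → ℝ → ℝ, Measurable (fun p : ℝ × Literature.MathematicalPhysics.KineticTheory.T3 × ℝ => R p.1 p.2.1 p.2.2) → (∀ s x s', s' ≤ Kstar ^ 2 → R s x s' = 0) → (∀ s x s', |R s x s'| ≤ |s'|) → ∀ η : ℝ, 0 < η → ∀ ε : ℝ, 0 < ε → ∃ τ₀ : ℝ, 0 < τ₀ ∧ ∀ τ : ℝ, τ₀ ≤ τ → ∃ N₀ : ℕ, ∀ N : ℕ, N₀ ≤ N → ∀ s ∈ Set.Icc 0 t₁, (let w : ℝ := τ * ((N : ℝ) + 1) ^ (-(1 / 3 : ℝ)); let P := Literature.MathematicalPhysics.KineticTheory.localGibbsLaw σ (a s) (u₀ s) (θ₀ s) N (Φ N); let W := fun (i : Fin (N + 1)) (r : ℝ) z => ((Φ N).flow r z i).2 - u₀ s ((Φ N).flow r z i).1; let cub := fun (i : Fin (N + 1)) z => w⁻¹ * ∫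 r in (0 : ℝ)..w, ‖W i r z‖ ^ 3; let cubBand := fun (i : Fin (N + 1)) z => w⁻¹ * ∫ r in (0 : ℝ)..w, (if Kstar < ‖W i r z‖ ∧ ‖W i r z‖ ≤ K₁ then ‖W i r z‖ ^ 3 else 0); let qbar := fun (i : Fin (N + 1)) z => w⁻¹ • ∫ r in (0 : ℝ)..w, (R s ((Φ N).flow r z i).1 (‖W i r z‖ ^ 2)) • W i r z; ∫⁻ z, ENNReal.ofReal (Real.exp ((8 * Θbar * K₁)⁻¹ * ∑ i : Fin (N + 1), (if η * cub i z < ‖qbar i z‖ then cubBand i z else 0))) ∂P ≤ ENNReal.ofReal (Real.exp (ε * ((N : ℝ) + 1))))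

/-- item stmt-AtomisticToContinuum-18052 · crux · rank 5 · closed · moot by None · by planner
why it might fail: As #3 plus UNIFORMITY: a sequence of normalised class members (growth 1) whose window pressure at a common tilt decays arbitrarily slowly in τ (slow odd modes near the collision kernel), or a 2nd-order soft-mode response not dominated by C; no print at fixed density.
sources: OllaVaradhanYau1993, NachtergaeleYau2003, KipnisLandim1999, doi:10.1016/0031-8914(69)90185-2, doi:10.1214/aop/1176993225, BGSSCPAM2023
[crux] KCWF-Q — THE QUANTITATIVE DOCKING NODE (rev-35 repair R1 of the Lean-refuted
BandCoherenceLDAlongFamilies stmt-17700, replaced 1:1): the kinetic-currents window LD along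
families (#3 KineticCurrentsLDAlongFamilies, stmt-16659) with the tilt threshold UNIFORM over the
normalised class — ∃η₀>0 ∀t₁ ∀ jointly continuous positive profile families (a_s, θ_s, u_s) ∀σ>0
with the packing guard σ³·sup a_s ≤ η₀∫a_s on [0,t₁] ∀ flow families Φ ∃β₀>0 ∀ weight families (A_s,
b_s, G_s) jointly continuous ∀C>0 with |F_s(x,v)| ≤ C(1+|v|²) on [0,t₁], F_s(x,v) = Σ_jk
A_s,jk(x)w_jw_k + (b_s(x)·w)G_s(x,|w|²), w = v − u_s(x), F_s ⊥ 1, v_j, |v|² under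
M_(1,u_s(x),θ_s(x)) at every (s,x) ∀β with |β|·C ≤ β₀ ∀ε>0 ∃τ₀ ∀τ≥τ₀ ∃N₀ ∀N≥N₀ ∀s∈[0,t₁]: ∫exp(β Σ_i
w_N⁻¹∫₀^{w_N} F_s(x_i(r),v_i(r))dr) dλ^N_s ≤ exp(ε(N+1)), w_N = τ(N+1)^(-1/3), λ^N_s = localGibbsLaw
σ a_s u_s θ_s N Φ_N (REFERENCE law). Differs from 16659 only in the position of ∃β₀ (before the
weights) and the normalisation |β|·C ≤ β₀; byte-identical (Iff.rfl, planner Sketch.lean rc 0) with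
the heart line's registered stub
`Theorems.HydroLimitInBandSignedBand.KineticCurrentsLDAlongFamiliesQ` (v16 of
Cruxes/HydroLimitInBand/Lines/IdeatorOneSketch.l -/
@[route_item "route-AtomisticToContinuum-OneFlightGossipEngine", crux]
def KineticCurrentsLDAlongFamiliesQ : Prop :=
  ∃ η₀ : ℝ, 0 < η₀ ∧ ∀ (t₁ : ℝ) (a θ₀ : ℝ → Literature.MathematicalPhysics.KineticTheory.T3 → ℝ) (u₀ : ℝ → Literature.MathematicalPhysics.KineticTheory.T3 → Literature.MathematicalPhysics.KineticTheory.V3), Continuous (Function.uncurry a) → Continuous (Function.uncurry θ₀) → Continuous (Function.uncurry u₀) → (∀ s x, 0 < a s x) → (∀ s x, 0 < θ₀ s x) → ∀ σ : ℝ, 0 < σ → (∀ s ∈ Set.Icc 0 t₁, σ ^ 3 * (⨆ x, a s x) ≤ η₀ * ∫ x, a s x) → ∀ Φ : (N : ℕ) → Literature.Analysis.FluidPDE.HardSphereFlow (Literature.Analysis.FluidPDE.Torus.geometry (Fin 3)) (Literature.MathematicalPhysics.KineticTheory.hsDiameter σ N) (N + 1), ∃ β₀ : ℝ, 0 < β₀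 ∧ ∀ (A : ℝ → Literature.MathematicalPhysics.KineticTheory.T3 → Fin 3 → Fin 3 → ℝ) (b : ℝ → Literature.MathematicalPhysics.KineticTheory.T3 → Literature.MathematicalPhysics.KineticTheory.V3) (G : ℝ → Literature.MathematicalPhysics.KineticTheory.T3 × ℝ → ℝ), Continuous (Function.uncurry A) → Continuous (Function.uncurry b) → Continuous (Function.uncurry G) → (let F := fun (s : ℝ) (y : Literature.MathematicalPhysics.KineticTheory.T3 × Literature.MathematicalPhysics.KineticTheory.V3) => (∑ j : Fin 3, ∑ k : Fin 3, A s y.1 j k * ((y.2 - u₀ s y.1) j * (y.2 - u₀ s y.1) k)) + (∑ j : Fin 3, b s y.1 j * (y.2 - u₀ s y.1) j) * G s (y.1, ‖y.2 - u₀ s y.1‖ ^ 2); ∀ C : ℝ, 0 < C → (∀ s ∈ Set.Icc 0 t₁, ∀ y : Literature.MathematicalPhysics.KineticTheory.T3 × Literature.MathematicalPhysics.KineticTheory.V3, |F s y| ≤ C * (1 + ‖y.2‖ ^ 2)) → (∀ s ∈ Set.Icc 0 t₁, ∀ x, ∫ v, F s (x, v) * Literature.Analysis.FluidPDE.localMaxwellian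 1 (θ₀ s x) (u₀ s x) v = 0) → (∀ s ∈ Set.Icc 0 t₁, ∀ x (j : Fin 3), ∫ v, F s (x, v) * v j * Literature.Analysis.FluidPDE.localMaxwellian 1 (θ₀ s x) (u₀ s x) v = 0) → (∀ s ∈ Set.Icc 0 t₁, ∀ x, ∫ v, F s (x, v) * ‖v‖ ^ 2 * Literature.Analysis.FluidPDE.localMaxwellian 1 (θ₀ s x) (u₀ s x) v = 0) → ∀ β : ℝ, |β| * C ≤ β₀ → ∀ ε : ℝ, 0 < ε → ∃ τ₀ : ℝ, 0 < τ₀ ∧ ∀ τ : ℝ, τ₀ ≤ τ → ∃ N₀ : ℕ, ∀ N : ℕ, N₀ ≤ N → ∀ s ∈ Set.Icc 0 t₁, ∫⁻ z, ENNReal.ofReal (Real.exp (β * ∑ i : Fin (N + 1), (τ * ((N : ℝ) + 1) ^ (-(1 / 3 : ℝ)))⁻¹ * ∫ r in (0 : ℝ)..(τ * ((N : ℝ) + 1) ^ (-(1 / 3 : ℝ))), F s ((Φ N).flow r z i))) ∂(Literature.MathematicalPhysics.KineticTheory.localGibbsLaw σ (a s) (u₀ s) (θ₀ s) N (Φ N))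 ≤ ENNReal.ofReal (Real.exp (ε * ((N : ℝ) + 1))))

/-- item stmt-AtomisticToContinuum-13734 · crux · rank 6 · closed · moot by None · by planner
why it might fail: No extensive a-priori bound on collision impulses under a non-equilibrium hard-sphere law is known (Serre2021/2024 bounds grow in N); entropy o(N) tolerates o(N) platooned/caged particles with unbounded activity; focusing could cage a positive fraction pre-shock.
sources: Serre2021, Serre2024, OllaVaradhanYau1993, BuragoFerlegerKononenko1998, CercignaniIllnerPulvirenti1994
[crux] A-PRIORI L¹ TAILS OF THE WINDOW COLLISIONAL ACTIVITY UNDER THE TRUE EVOLUTION (replaces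
ex-crux CollisionTransferTails stmt-AtomisticToContinuum-14444, which priced the global cap of the
refuted stmt-14441; prices the clamp of EquilibriumClampedCollisionalWindowLD in the dock). For
continuous profiles ∃σ₀ ∀σ ∈ (0,σ₀) ∀ classical hs-Euler solutions on [0,T) tied to the data by the
t = 0 LLN, ∀ flows, ∀ t < T ∃V₀ ∀V ≥ V₀ ∀ε > 0 ∃τ₀ ∀τ ≥ τ₀ ∃N₀ ∀N ≥ N₀ ∀s ∈ [0,t]: E_(λ₀)[(N+1)⁻¹
Σ_i a_i(s) 1{a_i(s) > V}] ≤ ε, where a_i(s) := (σ/τ) Σ_(collisions of i with times in (s, s+w])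
|v_i⁺ − v_i⁻| along the true trajectory from the local Gibbs data λ₀ (collisionSum), w =
τ(N+1)^(-1/3). Pathwise |w⁻¹(X_true − X_clamped)| ≤ ‖∇φ‖_∞ Σ_i a_i 1{a_i > V} (every dropped
collision has a clamped partner; contact ⇒ |φ(x_i)−φ(x_j)| ≤ ‖∇φ‖ε_N), so this is exactly the dock's
remainder. V₀ ≍ a few times sup_(x,s) 3θ(Z(ρσ³)−1) (the hydrodynamic activity level, finite
pre-shock); under the REFERENCE the tail is e^(−c(τ/σ)³)-small (a cage or dense droplet must have ≳
(τ√θ/(σδ′))³ members to outlive the window) plus a one-particle law of large numbers in τ; the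
content is that the TRUE pre-shock law develop -/
@[route_item "route-AtomisticToContinuum-OneFlightGossipEngine", crux]
def CollisionActivityTails : Prop :=
  ∀ (a₀ θ₀ : Literature.MathematicalPhysics.KineticTheory.T3 → ℝ) (u₀ : Literature.MathematicalPhysics.KineticTheory.T3 → Literature.MathematicalPhysics.KineticTheory.V3), Continuous a₀ → Continuous θ₀ → Continuous u₀ → (∀ x, 0 < a₀ x) → (∀ x, 0 < θ₀ x) → ∃ σ₀ : ℝ, 0 < σ₀ ∧ ∀ σ : ℝ, 0 < σ → σ < σ₀ → ∀ (T : ℝ) (ρ θ : ℝ → Literature.MathematicalPhysics.KineticTheory.T3 → ℝ) (u : ℝ → Literature.MathematicalPhysics.KineticTheory.T3 → Literature.MathematicalPhysics.KineticTheory.V3), Literature.MathematicalPhysics.KineticTheory.IsHardSphereEulerSolution σ T ρ u θ → ∀ Φ : (N : ℕ) → Literature.Analysis.FluidPDE.HardSphereFlow (Literature.Analysis.FluidPDE.Torus.geometry (Fin 3)) (Literature.MathematicalPhysics.KineticTheory.hsDiameter σ N) (N + 1), Literature.MathematicalPhysics.KineticTheory.TendstoHydroFieldsAt (fun N => Literature.MathematicalPhysics.KineticTheory.localGibbsLaw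 σ a₀ u₀ θ₀ N (Φ N)) Φ ρ u θ 0 → ∀ t ∈ Set.Ico 0 T, ∃ V₀ : ℝ, 0 < V₀ ∧ ∀ V : ℝ, V₀ ≤ V → ∀ ε : ℝ, 0 < ε → ∃ τ₀ : ℝ, 0 < τ₀ ∧ ∀ τ : ℝ, τ₀ ≤ τ → ∃ N₀ : ℕ, ∀ N : ℕ, N₀ ≤ N → ∀ s ∈ Set.Icc 0 t, (let w : ℝ := τ * ((N : ℝ) + 1) ^ (-(1 / 3 : ℝ)); let P := Literature.MathematicalPhysics.KineticTheory.localGibbsLaw σ a₀ u₀ θ₀ N (Φ N); let act := fun (i : Fin (N + 1)) (z : Literature.Analysis.FluidPDE.Config (N + 1) (Fin 3) Literature.MathematicalPhysics.KineticTheory.T3) => σ / τ * (Φ N).collisionSum (Set.Ioc s (s + w)) (fun c => if c.fst = i then ‖c.postVel.1 - c.preVel.1‖ else 0) z; ∫⁻ z, ENNReal.ofReal (((N : ℝ) + 1)⁻¹ * ∑ i : Fin (N + 1), Set.indicator {y : ℝ | V < y} (fun y => y) (act i z)) ∂P ≤ ENNReal.ofReal ε)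

/-- item stmt-AtomisticToContinuum-17701 · crux · rank 7 · closed · moot by None · by planner
why it might fail: Stronger than ECT: super-exponential decay in K of the empirical cubic tail under the TRUE law, uniformly in N. Entropy O(N) alone lets energy ~N sit on N^{1/3} fast particles (HighMomentumCutoffBarrier: e^{γ|p|³} not Maxwellian-integrable); only dynamics can forbid it — no tool.
sources: OllaVaradhanYau1993, NachtergaeleYau2003, Varadhan1993EntropyMethods, Literature.Barriers.AtomisticToContinuum.HighMomentumCutoffBarrierNarrow, Literature.Barriers.AtomisticToContinuum.lintegral_exp_cubic_eq_top, Spohn1991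
[crux] SUPER-EXPONENTIAL CUBIC VELOCITY TAILS UNDER THE TRUE PRE-SHOCK LAW (SEET; input of the dock
ClampedTransferDock, filed top-level by the judge-repair 2026-08-17 (the dock's glued split
flattened: route-repair seats cannot --split), line Sketch / crux-idea
superexp-tails-small-tilt-band; byte-identical (Iff.rfl) with the registered stub signature
`stub_seet` = Theorems.ClampedTransferDockCubicRate.SuperExponentialEnergyTails). For continuous
profiles ∃σ₀ ∀σ<σ₀ ∀ classical hs-Euler solutions on [0,T) tied to the data at t = 0 ∀ flow families
∀t<T ∀ rates c>0 ∃K₀ ∀K≥K₀ ∀ε>0 ∃N₀ ∀N≥N₀ ∀s∈[0,t]: E_λ₀[(N+1)⁻¹ Σ_i |v_i(s)|³ 1{|v_i(s)| > K}] ≤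
e^{−cK} + ε. The RATE form of EnergyCurrentTails (9235; ECT ⇐ SEET at rate one, landed in the line):
it pays the TOP (> K₁) of the suprathermal heat-flux remainder of the one-window ledger at a rate,
so the level K₁ is chosen after the accuracy (D-shape ledger ∀δ ∃K ∃ε) — this is what removes the
heart's true-law coherence child (ii). Fixed-time marginals only: a static-type a-priori tail bound
under the true law, no dynamics in the statement. Known: at s = 0 (local Gibbs data, Gaussian tails)
and under the catalogued hypothesis HighMomentumCu -/
@[route_item "route-AtomisticToContinuum-OneFlightGossipEngine", crux]
def SuperExponentialEnergyTails : Prop :=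
  ∀ (a₀ θ₀ : Literature.MathematicalPhysics.KineticTheory.T3 → ℝ) (u₀ : Literature.MathematicalPhysics.KineticTheory.T3 → Literature.MathematicalPhysics.KineticTheory.V3), Continuous a₀ → Continuous θ₀ → Continuous u₀ → (∀ x, 0 < a₀ x) → (∀ x, 0 < θ₀ x) → ∃ σ₀ : ℝ, 0 < σ₀ ∧ ∀ σ : ℝ, 0 < σ → σ < σ₀ → ∀ (T : ℝ) (ρ θ : ℝ → Literature.MathematicalPhysics.KineticTheory.T3 → ℝ) (u : ℝ → Literature.MathematicalPhysics.KineticTheory.T3 → Literature.MathematicalPhysics.KineticTheory.V3), Literature.MathematicalPhysics.KineticTheory.IsHardSphereEulerSolution σ T ρ u θ → ∀ Φ : (N : ℕ) → Literature.Analysis.FluidPDE.HardSphereFlow (Literature.Analysis.FluidPDE.Torus.geometry (Fin 3)) (Literature.MathematicalPhysics.KineticTheory.hsDiameter σ N) (N + 1), Literature.MathematicalPhysics.KineticTheory.TendstoHydroFieldsAt (fun N => Literature.MathematicalPhysics.KineticTheory.localGibbsLaw σ a₀ u₀ θ₀ N (Φ N)) Φ ρ u θ 0 → ∀ t ∈ Set.Ico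 0 T, ∀ c : ℝ, 0 < c → ∃ K₀ : ℝ, 0 < K₀ ∧ ∀ K : ℝ, K₀ ≤ K → ∀ ε : ℝ, 0 < ε → ∃ N₀ : ℕ, ∀ N : ℕ, N₀ ≤ N → ∀ s ∈ Set.Icc 0 t, ∫⁻ z, ENNReal.ofReal (((N : ℝ) + 1)⁻¹ * ∑ i : Fin (N + 1), Set.indicator {v : Literature.MathematicalPhysics.KineticTheory.V3 | K < ‖v‖} (fun v => ‖v‖ ^ 3) (((Φ N).flow s z i).2)) ∂(Literature.MathematicalPhysics.KineticTheory.localGibbsLaw σ a₀ u₀ θ₀ N (Φ N)) ≤ ENNReal.ofReal (Real.exp (-(c * K)) + ε)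

/-- item stmt-AtomisticToContinuum-17703 · crux · rank 8 · closed · moot by None · by planner
why it might fail: Dynamical, like 13734: no extensive a-priori bound on collisional ENERGY transfer under a non-equilibrium hard-sphere law (Serre's bounds grow in N); o(N) relative entropy tolerates o(N) caged/platooned particles exchanging unbounded energy in one window.
sources: Serre2021, Serre2024, OllaVaradhanYau1993, BuragoFerlegerKononenko1998, CercignaniIllnerPulvirenti1994
[crux] A-PRIORI L¹ TAILS OF THE WINDOW ENERGY-TRANSFER ACTIVITY UNDER THE TRUE PRE-SHOCK LAW — the
price of the energy half of the transfer clamp (input (iv) of the dock ClampedTransferDock, filed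
top-level by the judge-repair 2026-08-17; the energy twin of CollisionActivityTails 13734;
byte-identical (Iff.rfl) with Theorems.HydroLimitInBandOfHeart.CollisionEnergyActivityTails and the
registered stub `stub_energyActivityTails`; implied together with CAT by
TwoClocks.TransferActivityTails (stmt-16624) via the landed
HydroLimitInBandHeart.activityTails_of_transferActivityTails). For continuous profiles ∃σ₀ ∀σ<σ₀ ∀
classical hs-Euler solutions on [0,T) tied to the data at t = 0 ∀ flow families ∀t<T ∃V₀ ∀V≥V₀ ∀ε>0
∃τ₀ ∀τ≥τ₀ ∃N₀ ∀N≥N₀ ∀s∈[0,t]: E_λ₀[(N+1)⁻¹ Σ_i a^e_i(s) 1{a^e_i(s) > V}] ≤ ε, a^e_i(s) = (σ/τ)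
Σ_{collisions of i with times in (s,s+w]} |‖v_i⁺‖² − ‖v_i⁻‖²|/2 along the true trajectory, w =
τ(N+1)^{-1/3}. With CAT it bounds the pathwise transfer-clamp remainder of the dock (every dropped
collision has a partner of transfer activity > V; landed TransferClampRemainder p100385 and window
continuity p118327). Under the REFERENCE law the tail is e^{−c(τ/σ)³}-small plus a one-parti -/
@[route_item "route-AtomisticToContinuum-OneFlightGossipEngine", crux]
def EnergyActivityTails : Prop :=
  ∀ (a₀ θ₀ : Literature.MathematicalPhysics.KineticTheory.T3 → ℝ) (u₀ : Literature.MathematicalPhysics.KineticTheory.T3 → Literature.MathematicalPhysics.KineticTheory.V3), Continuous a₀ → Continuous θ₀ → Continuous u₀ → (∀ x, 0 < a₀ x) → (∀ x, 0 < θ₀ x) → ∃ σ₀ : ℝ, 0 < σ₀ ∧ ∀ σ : ℝ, 0 < σ → σ < σ₀ → ∀ (T : ℝ) (ρ θ : ℝ → Literature.MathematicalPhysics.KineticTheory.T3 → ℝ) (u : ℝ → Literature.MathematicalPhysics.KineticTheory.T3 → Literature.MathematicalPhysics.KineticTheory.V3), Literature.MathematicalPhysics.KineticTheory.IsHardSphereEulerSolution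 σ T ρ u θ → ∀ Φ : (N : ℕ) → Literature.Analysis.FluidPDE.HardSphereFlow (Literature.Analysis.FluidPDE.Torus.geometry (Fin 3)) (Literature.MathematicalPhysics.KineticTheory.hsDiameter σ N) (N + 1), Literature.MathematicalPhysics.KineticTheory.TendstoHydroFieldsAt (fun N => Literature.MathematicalPhysics.KineticTheory.localGibbsLaw σ a₀ u₀ θ₀ N (Φ N)) Φ ρ u θ 0 → ∀ t ∈ Set.Ico 0 T, ∃ V₀ : ℝ, 0 < V₀ ∧ ∀ V : ℝ, V₀ ≤ V → ∀ ε : ℝ, 0 < ε → ∃ τ₀ : ℝ, 0 < τ₀ ∧ ∀ τ : ℝ, τ₀ ≤ τ → ∃ N₀ : ℕ, ∀ N : ℕ, N₀ ≤ N → ∀ s ∈ Set.Icc 0 t, (let w : ℝ := τ * ((N : ℝ) + 1) ^ (-(1 / 3 : ℝ)); let P := Literature.MathematicalPhysics.KineticTheory.localGibbsLaw σ a₀ u₀ θ₀ N (Φ N); let act := fun (i : Fin (N + 1)) z => σ / τ * (Φ N).collisionSum (Set.Ioc s (s + w)) (fun c => if c.fst = i then |‖c.postVel.1‖ ^ 2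 - ‖c.preVel.1‖ ^ 2| / 2 else 0) z; ∫⁻ z, ENNReal.ofReal (((N : ℝ) + 1)⁻¹ * ∑ i : Fin (N + 1), Set.indicator {y : ℝ | V < y} (fun y => y) (act i z)) ∂P ≤ ENNReal.ofReal ε)

/-- item stmt-AtomisticToContinuum-17733 · crux · rank 11 · closed · proved by Summit.AtomisticToContinuum.HydrodynamicLimit.Theorems.ClampedTransferDockSketch.clampedTransferDockOfInputs_proof @ 2243e09223b3 (prover) · by planner
why it might fail: It cannot, short of a landed file un-building: provable now as Theorems.ClampedTransferDockSketch.clampedTransferDock_of_inputs (p140743) ∘ (SEET ⇒ ECT at rate one, Check3.lean rc0). Crux-kind only because binders of `closes` must be cruxes; the bet is its six antecedents.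
sources: Yau1991, OllaVaradhanYau1993, KipnisLandim1999, Summit.AtomisticToContinuum.HydrodynamicLimit.Theorems.ClampedTransferDockSketch.clampedTransferDock_of_inputs
[crux] THE DOCK OVER ITS REAL INPUTS — PROVABLE NOW (judge-repair 2026-08-17; the glue of the dock's
split, flattened to the first layer because a route-repair seat cannot `--split`):
SuperExponentialEnergyTails → BandCoherenceLDAlongFamilies → LocalClampedTransferLDAlongFamilies →
EnergyActivityTails → KineticCurrentsLDAlongFamilies → CollisionActivityTails → HydrodynamicLimit
(the packing-guarded conjunct). This is the dock `ClampedTransferDock` (stmt-17615: KCWF → CAT → ECT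
→ HL) composed with its four conjecture-grade inputs and with ECT discharged by SEET at rate one;
definitionally the type of the LANDED sorry-free
`Theorems.ClampedTransferDockSketch.clampedTransferDock_of_inputs` (p140743 — line Sketch of the
dock: rate window clause p139114, per-window estimate p136014, rate cubic channel p138311, D-shape
ledger end p139514, window continuity p118327, over the shared one-window HEART of Yau's
relative-entropy clock along a_s = ρ_s·Rf(σ³ρ_s)) up to `energyCurrentTails_of_seet : SEET → ECT`
(15 lines; planner folder SeetEct.lean / Check3.lean rc 0, attached as evidence). One-line proof for
any prover, in a Theorems file importing …ClampedTransferDockOfInputs: `theorem clamped -/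
@[route_item "route-AtomisticToContinuum-OneFlightGossipEngine"]
def ClampedTransferDockOfInputs : Prop :=
  SuperExponentialEnergyTails → BandCoherenceLDAlongFamilies → LocalClampedTransferLDAlongFamilies → EnergyActivityTails → KineticCurrentsLDAlongFamilies → CollisionActivityTails → _root_.HydrodynamicLimit

/-- item stmt-AtomisticToContinuum-18054 · crux · rank 11 · closed · proved by Summit.AtomisticToContinuum.HydrodynamicLimit.Theorems.ClampedTransferDockQ.clampedTransferDockOfInputsQ_proof @ eb8c87eb2eda (prover) · by planner
why it might fail: Only through a typing slip in the signed channel: the re-orthogonalisation defect ρ·ω₀ not bookable as a Gaussian tail with SEET's top, or WindowClauseRateS's conclusion drifting from the landed clause p139114; mathematically modus ponens over the landed heart.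
sources: Yau1991, OllaVaradhanYau1993, NachtergaeleYau2003, KipnisLandim1999, Summit.AtomisticToContinuum.HydrodynamicLimit.Theorems.HydroLimitInBandSignedBand.kcwf_of_kcwfQ
[crux] DOCK-Q — THE DOCK OVER THE REPAIRED INPUTS (rev-35 1:1 replacement of
ClampedTransferDockOfInputs stmt-17733, which was proved over the now-refuted BCL):
SuperExponentialEnergyTails → KineticCurrentsLDAlongFamiliesQ → LocalClampedTransferLDAlongFamilies
→ EnergyActivityTails → KineticCurrentsLDAlongFamilies → CollisionActivityTails → HydrodynamicLimit
(the packing-guarded conjunct). Yau's Liouville-invariant relative entropy along the explicit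
reference family a_s = ρ_s·Rf(σ³ρ_s) with ONE common window — the shared HEART, all landed
(per-window estimate p136014, D-shape ledger end p139514, window continuity p118327, a-priori bound
p109679, reduction p97252, dock p97115, SEET ⇒ ECT p141132) — with the suprathermal cubic channel
re-threaded SIGNED around BCL: it is the composition `HydroLimitInBand_of` of the heart's skeleton
v16 (Cruxes/HydroLimitInBand/Lines/IdeatorOneSketch.lean, lead prover-line-9133-c17; inputs exactly
{KCWF-Q, SEET, LCT, EAT, CAT}) once its four registered PROVABLE stubs land as Theorems:
BandShiftStatics (re-orthogonalised band truncation, static Gaussian analysis), KineticInstanceOrth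
(KC1 with its cut-off's momentum-orthogonality exported), CubicChann -/
@[route_item "route-AtomisticToContinuum-OneFlightGossipEngine", crux]
def ClampedTransferDockOfInputsQ : Prop :=
  SuperExponentialEnergyTails → KineticCurrentsLDAlongFamiliesQ → LocalClampedTransferLDAlongFamilies → EnergyActivityTails → KineticCurrentsLDAlongFamilies → CollisionActivityTails → _root_.HydrodynamicLimit

/-- item stmt-AtomisticToContinuum-14662 · support · rank 3 · closed · moot by None · by planner
why it might fail: Scale-N window LD needs ALL scaled cumulants of the window average to vanish, not only the conditional means gossip gives; ring-induced heavy tails of the kick martingale at LD scale; the activity-ratio guard may miss a local packing threshold; no print at fixed density, open even at global Gibbs.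
sources: OllaVaradhanYau1993, KipnisLandim1999, BGSSCPAM2023
[crux] THE DOCKING NODE — KINETIC FAST CURRENTS, FINITE KINETIC WINDOW, LOCAL GIBBS DATA, η₀-UNIFORM
(rev-7 re-dock; the restricted-class sibling of TwoClocks.KineticWindowLDUniform stmt-14442 and the
η₀-uniform strengthening of this route's profile-wise stmt-9530, which it implies profile by profile
with σ₀ := (η₀∫a/sup a)^{1/3}). ∃ η₀ > 0 ∀ continuous a, θ₀ > 0, u₀ ∀ σ > 0 with σ³·sup_x a(x) ≤
η₀·∫a ∀ flow families Φ_N ∀ F(x,v) = Σ_jk A_jk(x) w_j w_k + (Σ_j b_j(x) w_j)·G(x,|w|²), w = v −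
u₀(x), A, b, G continuous, |F| ≤ C(1+|v|²), F ⊥ 1, v_j, |v|² under M_(1,u₀(x),θ₀(x)) at every x: ∃
β₀ > 0 ∀ |β| ≤ β₀ ∀ ε > 0 ∃ τ > 0 ∃ N₀ ∀ N ≥ N₀: ∫ exp(β Σ_i w_N⁻¹ ∫₀^{w_N} F(x_i(r), v_i(r)) dr)
dλ^N ≤ exp(ε(N+1)), w_N = τ(N+1)^(-1/3), λ^N = localGibbsLaw σ a u₀ θ₀ N Φ_N. What `closes` consumes
on the kinetic side; the class is exactly what the entropy production of the Euler closure generates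
(traceless stress against ∇u-weights, heat flux w(|w|²−5θ) against ∇θ-weights) and exactly what the
gossip engine delivers (GossipStressIdentity for the A-part, KacPairHeatFlux for the b·w·G part).
Intended line (crux protocol on this node): OneFlightLayeredChaos ⇒ pathwise gossip decomposition
c_fin = Wc -/
@[route_item "route-AtomisticToContinuum-OneFlightGossipEngine"]
def KineticCurrentsWindowLDUniform : Prop :=
  ∃ η₀ : ℝ, 0 < η₀ ∧ ∀ (a θ₀ : Literature.MathematicalPhysics.KineticTheory.T3 → ℝ) (u₀ : Literature.MathematicalPhysics.KineticTheory.T3 → Literature.MathematicalPhysics.KineticTheory.V3), Continuous a → Continuous θ₀ → Continuous u₀ → (∀ x, 0 < a x) → (∀ x, 0 < θ₀ x) → ∀ σ : ℝ, 0 < σ → σ ^ 3 * (⨆ x, a x) ≤ η₀ * ∫ x, a x → ∀ Φ : (N : ℕ) → Literature.Analysis.FluidPDE.HardSphereFlow (Literature.Analysis.FluidPDE.Torus.geometry (Fin 3)) (Literature.MathematicalPhysics.KineticTheory.hsDiameter σ N) (N + 1), ∀ (A : Literature.MathematicalPhysics.KineticTheory.T3 → Fin 3 → Fin 3 → ℝ)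 (b : Literature.MathematicalPhysics.KineticTheory.T3 → Literature.MathematicalPhysics.KineticTheory.V3) (G : Literature.MathematicalPhysics.KineticTheory.T3 × ℝ → ℝ), Continuous A → Continuous b → Continuous G → (∃ C : ℝ, ∀ y : Literature.MathematicalPhysics.KineticTheory.T3 × Literature.MathematicalPhysics.KineticTheory.V3, |(fun y : Literature.MathematicalPhysics.KineticTheory.T3 × Literature.MathematicalPhysics.KineticTheory.V3 => ((∑ j : Fin 3, ∑ k : Fin 3, A y.1 j k * ((y.2 - u₀ y.1) j * (y.2 - u₀ y.1) k)) + (∑ j : Fin 3, b y.1 j * (y.2 - u₀ y.1) j) * G (y.1, ‖y.2 - u₀ y.1‖ ^ 2))) y| ≤ C * (1 + ‖y.2‖ ^ 2)) → (∀ x, ∫ v, (fun y : Literature.MathematicalPhysics.KineticTheory.T3 × Literature.MathematicalPhysics.KineticTheory.V3 => ((∑ j : Fin 3, ∑ k : Fin 3, A y.1 j k * ((y.2 - u₀ y.1) j * (y.2 - u₀ y.1) k)) + (∑ j : Fin 3, b y.1 j * (y.2 - u₀ y.1) j) * G (y.1, ‖y.2 - u₀ y.1‖ ^ 2))) (x,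 v) * Literature.Analysis.FluidPDE.localMaxwellian 1 (θ₀ x) (u₀ x) v = 0) → (∀ x (j : Fin 3), ∫ v, (fun y : Literature.MathematicalPhysics.KineticTheory.T3 × Literature.MathematicalPhysics.KineticTheory.V3 => ((∑ j : Fin 3, ∑ k : Fin 3, A y.1 j k * ((y.2 - u₀ y.1) j * (y.2 - u₀ y.1) k)) + (∑ j : Fin 3, b y.1 j * (y.2 - u₀ y.1) j) * G (y.1, ‖y.2 - u₀ y.1‖ ^ 2))) (x, v) * v j * Literature.Analysis.FluidPDE.localMaxwellian 1 (θ₀ x) (u₀ x) v = 0) → (∀ x, ∫ v, (fun y : Literature.MathematicalPhysics.KineticTheory.T3 × Literature.MathematicalPhysics.KineticTheory.V3 => ((∑ j : Fin 3, ∑ k : Fin 3, A y.1 j k * ((y.2 - u₀ y.1) j * (y.2 - u₀ y.1) k)) + (∑ j : Fin 3, b y.1 j * (y.2 - u₀ y.1) j) * G (y.1, ‖y.2 - u₀ y.1‖ ^ 2))) (x, v) * ‖v‖ ^ 2 * Literature.Analysis.FluidPDE.localMaxwellian 1 (θ₀ x) (u₀ x) v = 0) → ∃ β₀ : ℝ,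 0 < β₀ ∧ ∀ β : ℝ, |β| ≤ β₀ → ∀ ε : ℝ, 0 < ε → ∃ τ : ℝ, 0 < τ ∧ ∃ N₀ : ℕ, ∀ N : ℕ, N₀ ≤ N → ∫⁻ z, ENNReal.ofReal (Real.exp (β * ∑ i : Fin (N + 1), (τ * ((N : ℝ) + 1) ^ (-(1 / 3 : ℝ)))⁻¹ * ∫ r in (0 : ℝ)..(τ * ((N : ℝ) + 1) ^ (-(1 / 3 : ℝ))), (fun y : Literature.MathematicalPhysics.KineticTheory.T3 × Literature.MathematicalPhysics.KineticTheory.V3 => ((∑ j : Fin 3, ∑ k : Fin 3, A y.1 j k * ((y.2 - u₀ y.1) j * (y.2 - u₀ y.1) k)) + (∑ j : Fin 3, b y.1 j * (y.2 - u₀ y.1) j) * G (y.1, ‖y.2 - u₀ y.1‖ ^ 2))) (((Φ N).flow r z) i))) ∂(Literature.MathematicalPhysics.KineticTheory.localGibbsLaw σ a u₀ θ₀ N (Φ N)) ≤ ENNReal.ofReal (Real.exp (ε * ((N : ℝ) + 1)))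

/-- item stmt-AtomisticToContinuum-9531 · support · rank 4 · closed · moot by None · by planner
why it might fail: At fixed σ the one-flight defects (near-miss conditioning ε/r, distortion r/ℓ) may not decay along layers — a perturbative Cesàro floor O(σ^{3/4}) instead of 0; removing it needs an N-uniform self-improving coupling step unknown even for one 3-D particle beyond finite horizon; no N-uniform print.
sources: BGSSCPAM2023, ChernovDolgopyat2009, doi:10.4171/022-2/80, BalintToth2008, doi:10.1109/tit.2006.874516, Dorfman1999
[crux] EQUILIBRIUM KINETIC SHEAR-STRESS DECORRELATION, UNIFORM IN N, AT FIXED SMALL DENSITY (card B2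
made a deliverable; the cheapest typed rung: second-cumulant, global-Gibbs shadow of
KineticCurrentsWindowLD / ex-3656). For constants a₀, θ₀ > 0 there is σ₀ > 0 such that for 0 < σ <
σ₀, every family of hard-sphere flows Φ_N (N+1 spheres of diameter hsDiameter σ N on 𝕋³) and every
continuous φ : 𝕋³ → ℝ: with λ^N = localGibbsLaw σ a₀ 0 θ₀ N Φ_N (canonical Gibbs, flow-invariant),
w_N = τ(N+1)^{-1/3} (τ mean-free-time units) and Ȳ_τ(z) = (N+1)⁻¹ Σ_i w_N⁻¹ ∫₀^{w_N} φ(x_i(r))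
v_i¹(r) v_i²(r) dr along Φ_N.flow r z: lim_{τ→∞} limsup_{N→∞} (N+1)·E_{λ^N}[Ȳ_τ²] = 0. Equivalently:
the per-particle autocorrelation of the kinetic shear stress is Cesàro-null on kinetic times
uniformly in N (prediction (N+1)E[Ȳ_τ²] ≍ θ₀²⟨φ²⟩(c₁ + c₂ log τ)/τ; tails integrable in d=3).
Engine: B1′ ⇒ E[stress(t)|𝒢₀] = stress of gossip-averaged velocities + defects ⇒
Cov(stress(0),stress(t)) ≤ E|T(0)|(‖gossip average‖² + Σ defects). [deps: GossipStressIdentity]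
[difficulty: open-problem] -/
@[route_item "route-AtomisticToContinuum-OneFlightGossipEngine"]
def EquilibriumStressVarianceDecay : Prop :=
  ∀ (a₀ θ₀ : ℝ), 0 < a₀ → 0 < θ₀ → ∃ σ₀ : ℝ, 0 < σ₀ ∧ ∀ σ : ℝ, 0 < σ → σ < σ₀ → ∀ Φ : (N : ℕ) → Literature.Analysis.FluidPDE.HardSphereFlow (Literature.Analysis.FluidPDE.Torus.geometry (Fin 3)) (Literature.MathematicalPhysics.KineticTheory.hsDiameter σ N) (N + 1), ∀ φ : Literature.MathematicalPhysics.KineticTheory.T3 → ℝ, Continuous φ → Filter.Tendsto (fun τ : ℝ => Filter.limsup (fun N : ℕ => ((N : ENNReal) + 1) * ∫⁻ z, ENNReal.ofReal ((((N : ℝ) + 1)⁻¹ * ∑ i : Fin (N + 1), (τ * ((N : ℝ) + 1) ^ (-(1 / 3 : ℝ)))⁻¹ * ∫ r in (0 : ℝ)..(τ * ((N : ℝ) + 1) ^ (-(1 / 3 : ℝ))), φ ((Φ N).flow r z i).1 * (((Φ N).flow r z i).2 0 * ((Φ N).flow r z i).2 1)) ^ 2) ∂(Literature.MathematicalPhysics.KineticTheory.localGibbsLaw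 σ (fun _ => a₀) (fun _ => 0) (fun _ => θ₀) N (Φ N))) Filter.atTop) Filter.atTop (nhds 0)

/-- item stmt-AtomisticToContinuum-9532 · support · rank 5 · closed · moot by None · by planner
why it might fail: Cubic observable: the 2/3-damped gossip needs factorisation of cubic CROSS moments of colliding partners (partner-selection chaos, not given by angles) plus velocity-tail control; persistence gives only 2/3 per collision, late mass escapes damping on non-round schedules; can fail with C3 true.
sources: doi:10.1512/iumj.1956.5.55001, doi:10.1007/bf02392695, doi:10.1137/070695423, doi:10.1142/s0218202515500256, Lutsko1996, BGSSCPAM2023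
[crux] EQUILIBRIUM KINETIC HEAT-FLUX DECORRELATION, UNIFORM IN N (card B2, cubic moment). Same
setting as EquilibriumStressVarianceDecay with the FAST part of the kinetic energy current, F(x,v) =
φ(x)(v¹|v|² − 5θ₀v¹) (v¹|v|² minus its L²(M_{0,θ₀}) projection 5θ₀v¹ onto the collision invariant
v¹; mean zero and orthogonal to 1, v, |v|² under the centred Maxwellian): lim_{τ→∞} limsup_N
(N+1)·E_{λ^N}[Ȳ_τ²] = 0. Engine: on ring-sparse (tree) schedules with independent mean-zero inputs
the per-particle expected heat-flux vector follows the 2/3-DAMPED gossip q ↦ (2/3)·A_{ij}q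
(KacPairHeatFlux + induction), so ‖q‖₁ contracts by (2/3)^m over m rounds in which every particle
collides; at equilibrium partner velocities are independent at time 0 and ring collisions are
O(σ³)-rare per flight. [deps: KacPairHeatFlux, EquilibriumStressVarianceDecay] [difficulty:
open-problem] -/
@[route_item "route-AtomisticToContinuum-OneFlightGossipEngine"]
def EquilibriumHeatFluxVarianceDecay : Prop :=
  ∀ (a₀ θ₀ : ℝ), 0 < a₀ → 0 < θ₀ → ∃ σ₀ : ℝ, 0 < σ₀ ∧ ∀ σ : ℝ, 0 < σ → σ < σ₀ → ∀ Φ : (N : ℕ) → Literature.Analysis.FluidPDE.HardSphereFlow (Literature.Analysis.FluidPDE.Torus.geometry (Fin 3)) (Literature.MathematicalPhysics.KineticTheory.hsDiameter σ N) (N + 1), ∀ φ : Literature.MathematicalPhysics.KineticTheory.T3 → ℝ, Continuous φ → Filter.Tendsto (fun τ : ℝ => Filter.limsup (fun N : ℕ => ((N : ENNReal) + 1) * ∫⁻ z, ENNReal.ofReal ((((N : ℝ) + 1)⁻¹ * ∑ i : Fin (N + 1), (τ * ((N : ℝ) + 1) ^ (-(1 / 3 : ℝ)))⁻¹ * ∫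 r in (0 : ℝ)..(τ * ((N : ℝ) + 1) ^ (-(1 / 3 : ℝ))), φ ((Φ N).flow r z i).1 * (((Φ N).flow r z i).2 0 * ‖((Φ N).flow r z i).2‖ ^ 2 - 5 * θ₀ * ((Φ N).flow r z i).2 0)) ^ 2) ∂(Literature.MathematicalPhysics.KineticTheory.localGibbsLaw σ (fun _ => a₀) (fun _ => 0) (fun _ => θ₀) N (Φ N))) Filter.atTop) Filter.atTop (nhds 0)

/-- item stmt-AtomisticToContinuum-3091 · support · rank 7 · open · by planner
why it might fail: Smooth implosions of 3-D compressible Euler (MerleEtAl2022, BuckmasterCaolaboraGomezserrano2025) have sup ρ_t → ∞ as t ↑ T*; if implosion from smooth positive data on 𝕋³ survives the O(σ³) hard-sphere EOS perturbation, ρ_tσ³ < η fails near T* at every fixed σ.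
sources: Sideris1985, MerleEtAl2022, BuckmasterCaolaboraGomezserrano2025, Spohn1991, OllaVaradhanYau1993
[crux] (card crux 1B ∪ 3; the hidden PDE crux of every route) for every η > 0 and all continuous
positive profiles there is σ₀ > 0 such that for 0 < σ < σ₀, every classical hard-sphere-Euler
solution on [0,T) whose t = 0 fields are the LLN limit of the local Gibbs laws satisfies ρ_t(x)σ³ <
η for all t < T and x — i.e. limsup_{σ→0} σ³ sup_{t<T*_σ} ‖ρ_σ(t)‖_∞ = 0 profile by profile. For
profiles whose ideal-gas development is global or breaks by a non-degenerate shock (Luk–Speck /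
Buckmaster–Shkoller–Vicol open sets) this is stability of shock formation under an O(σ³)
equation-of-state and data perturbation; in general it is a σ-uniform density bound at the FIRST
singularity of 3-D compressible Euler for all smooth data. [deps: EosContinuity,
LocalGibbsDensityLimit] [difficulty: open-problem] -/
@[route_item "route-AtomisticToContinuum-OneFlightGossipEngine"]
def DiluteSelfConsistency : Prop :=
  ∀ η : ℝ, 0 < η → ∀ (a₀ θ₀ : Literature.MathematicalPhysics.KineticTheory.T3 → ℝ) (u₀ : Literature.MathematicalPhysics.KineticTheory.T3 → Literature.MathematicalPhysics.KineticTheory.V3), Continuous a₀ → Continuous θ₀ → Continuous u₀ → (∀ x, 0 < a₀ x) → (∀ x, 0 < θ₀ x) → ∃ σ₀ : ℝ, 0 < σ₀ ∧ ∀ σ : ℝ, 0 < σ → σ < σ₀ → ∀ (T : ℝ) (ρ θ : ℝ → Literature.MathematicalPhysics.KineticTheory.T3 → ℝ) (u : ℝ → Literature.MathematicalPhysics.KineticTheory.T3 → Literature.MathematicalPhysics.KineticTheory.V3), Literature.MathematicalPhysics.KineticTheory.IsHardSphereEulerSolution σ T ρ u θ → ∀ Φ : (N : ℕ) → Literature.Analysis.FluidPDE.HardSphereFlow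 (Literature.Analysis.FluidPDE.Torus.geometry (Fin 3)) (Literature.MathematicalPhysics.KineticTheory.hsDiameter σ N) (N + 1), Literature.MathematicalPhysics.KineticTheory.TendstoHydroFieldsAt (fun N => Literature.MathematicalPhysics.KineticTheory.localGibbsLaw σ a₀ u₀ θ₀ N (Φ N)) Φ ρ u θ 0 → ∀ t ∈ Set.Ico 0 T, ∀ x, ρ t x * σ ^ 3 < η

/-- item stmt-AtomisticToContinuum-0768 · support · rank 9 · closed · proved by Summit.AtomisticToContinuum.HydrodynamicLimit.Theorems.hsEosLowDensity_proof (prover) · by planner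
sources: Ruelle1969, LebowitzPenrose1964
[support] Hard-sphere equation of state at low density: ∃ η₀ > 0 and F real-analytic on (−η₀, η₀)
with hsExcessFreeEnergy = F on [0, η₀), F(0) = 0, F'(0) = 2π/3 (second virial coefficient of
unit-diameter spheres), and the canonical thermodynamic limit −N⁻¹ log hsFreeVolume η N → F(η)
exists (not just limsup) for η ∈ [0, η₀). Ruelle1969 §3.4 (existence), LebowitzPenrose1964
(convergence of the virial expansion ⇒ analyticity). Makes hsCompressibility/hsPressure smooth and
Z(η) = 1 + (2π/3)η + O(η²); needed by every route (hyperbolicity of the Euler system, virial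
theorem). -/
@[route_item "route-AtomisticToContinuum-OneFlightGossipEngine"]
def HsEosLowDensity : Prop :=
  ∃ η₀ : ℝ, 0 < η₀ ∧ ∃ F : ℝ → ℝ, AnalyticOnNhd ℝ F (Set.Ioo (-η₀) η₀) ∧ Set.EqOn Literature.MathematicalPhysics.KineticTheory.hsExcessFreeEnergy F (Set.Ico 0 η₀) ∧ F 0 = 0 ∧ deriv F 0 = 2 * Real.pi / 3 ∧ ∀ η ∈ Set.Ico 0 η₀, Filter.Tendsto (fun N : ℕ => -(N : ℝ)⁻¹ * Real.log (Literature.MathematicalPhysics.KineticTheory.hsFreeVolume η N)) Filter.atTop (nhds (F η))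

/-- `HsEosLowDensity` holds: proved by `Summit.AtomisticToContinuum.HydrodynamicLimit.Theorems.hsEosLowDensity_proof`. -/
theorem HsEosLowDensity_holds : HsEosLowDensity := _root_.Summit.AtomisticToContinuum.HydrodynamicLimit.Theorems.hsEosLowDensity_proof

/-- item stmt-AtomisticToContinuum-14445 · support · rank 9 · closed · proved by Summit.AtomisticToContinuum.HydrodynamicLimit.Theorems.uniformLocalGibbsConcentration_proof (prover) · by planner
sources: Ruelle1969, LebowitzPenrose1964, KipnisLandim1999
[support] η₀-UNIFORM EXPONENTIAL LLN FOR CANONICAL LOCAL GIBBS STATES (the consumable strengthening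
of stmt-0767, whose σ₀ is profile-wise): ∃ η₀ > 0 ∀ continuous a, θ₀ > 0, u₀ ∀ σ > 0 with σ³·sup a ≤
η₀ ∫a: the laws localGibbsLaw σ a u₀ θ₀ N Φ are probability measures for all N, Φ, and there is a
continuous density profile ρ₀ > 0 such that the empirical density/momentum/energy fields tested
against any continuous χ concentrate exponentially (≤ C e^(−(N+1)/C)) around ∫χρ₀, ∫χρ₀u₀,
∫χE(ρ₀,u₀,θ₀). Static: low-density cluster expansion. [difficulty: M] -/
@[route_item "route-AtomisticToContinuum-OneFlightGossipEngine"]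
def UniformLocalGibbsConcentration : Prop :=
  ∃ η₀ : ℝ, 0 < η₀ ∧ ∀ (a θ₀ : Literature.MathematicalPhysics.KineticTheory.T3 → ℝ) (u₀ : Literature.MathematicalPhysics.KineticTheory.T3 → Literature.MathematicalPhysics.KineticTheory.V3), Continuous a → Continuous θ₀ → Continuous u₀ → (∀ x, 0 < a x) → (∀ x, 0 < θ₀ x) → ∀ σ : ℝ, 0 < σ → σ ^ 3 * (⨆ x, a x) ≤ η₀ * ∫ x, a x → ∃ ρ₀ : Literature.MathematicalPhysics.KineticTheory.T3 → ℝ, Continuous ρ₀ ∧ (∀ x, 0 < ρ₀ x) ∧ (∀ (N : ℕ) (Φ : Literature.Analysis.FluidPDE.HardSphereFlow (Literature.Analysis.FluidPDE.Torus.geometry (Fin 3)) (Literature.MathematicalPhysics.KineticTheory.hsDiameter σ N) (N + 1)), MeasureTheory.IsProbabilityMeasure (Literature.MathematicalPhysics.KineticTheory.localGibbsLaw σ a u₀ θ₀ N Φ)) ∧ ∀ χ : Literature.MathematicalPhysics.KineticTheory.T3 → ℝ, Continuous χ → ∀ δ : ℝ, 0 < δ → ∃ C : ℝ, 0 < C ∧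 ∀ (N : ℕ) (Φ : Literature.Analysis.FluidPDE.HardSphereFlow (Literature.Analysis.FluidPDE.Torus.geometry (Fin 3)) (Literature.MathematicalPhysics.KineticTheory.hsDiameter σ N) (N + 1)), Literature.MathematicalPhysics.KineticTheory.localGibbsLaw σ a u₀ θ₀ N Φ {z | δ < |Literature.MathematicalPhysics.KineticTheory.empiricalDensityField z χ - ∫ x, χ x * ρ₀ x|} ≤ ENNReal.ofReal (C * Real.exp (-(C⁻¹ * (N + 1)))) ∧ Literature.MathematicalPhysics.KineticTheory.localGibbsLaw σ a u₀ θ₀ N Φ {z | δ < ‖Literature.MathematicalPhysics.KineticTheory.empiricalMomentumField z χ - ∫ x, (χ x * ρ₀ x) • u₀ x‖} ≤ ENNReal.ofReal (C * Real.exp (-(C⁻¹ * (N + 1)))) ∧ Literature.MathematicalPhysics.KineticTheory.localGibbsLaw σ a u₀ θ₀ N Φ {z | δ < |Literature.MathematicalPhysics.KineticTheory.empiricalEnergyField z χ - ∫ x, χ x * Literature.MathematicalPhysics.KineticTheory.totalEnergyDensity (ρ₀ x) (u₀ x) (θ₀ x)|} ≤ ENNReal.ofReal (C * Real.exp (-(C⁻¹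 * (N + 1))))

/-- item stmt-AtomisticToContinuum-16766 · support · rank 9 · closed · moot by None · by planner
sources: doi:10.1109/tit.2006.874516, ChernovDolgopyat2009, OllaVaradhanYau1993, KipnisLandim1999, Varadhan1993EntropyMethods, BGSSCPAM2023
[support] GLUE — THE ENGINE CONTRACT, re-targeted (rev 26; replaces the rev-17 GossipConsumptionGlue
OFLC → KineticCurrentsWindowLDUniform, dropped in rev 20 for want of a slot): the rank-2 mechanism
crux DELIVERS THE DOCKING NODE ALONG FAMILIES, OneFlightLayeredChaos →
KineticCurrentsLDAlongFamilies, so that B1′ sits inside the cone of `closes` (the node is then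
reached either directly or as {B1′, this glue}; `closes` keeps its crux-only binders hK h₇ h₆ hS
hD). It is the item form of the line the thesis calls ENGINE and the two-layer plan spells out
(nothing new is claimed): (i) consumption — hard-sphere kinematics = pairwise averaging + kick, so
GIVEN per-collision kick fairness up to Cσ^p (B1′) the conditional-mean forecast of the window
current of the restricted class is CLOSED-FORM: the traceless form of the gossip-averaged velocities
for the A-part (GossipStressIdentity 9533, PROVED, termwise) and the 2/3-damped gossip for the
(b·w)G part (KacPairHeatFlux 9534, PROVED, + tree induction and factorisation of cubic cross moments
at contact); (ii) the LD step at scale N — the sparse-kick relative-entropy ledger of the 14662 line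
(crux-idea gossip-forecast-ledger: chain rule + fi -/
@[route_item "route-AtomisticToContinuum-OneFlightGossipEngine", crux]
def GossipConsumptionGlue : Prop :=
  OneFlightLayeredChaos → KineticCurrentsLDAlongFamilies

/-- item stmt-AtomisticToContinuum-17947 · support · rank 9 · closed · moot by None · by planner
[support] re-ask of the PROVED exact gossip closure identity (stmt-9533) to refresh its route badge
(kind support) after a half-applied retriage left kind 'aside' on it; no statement change -/
@[route_item "route-AtomisticToContinuum-OneFlightGossipEngine"]
def GossipStressIdentity : Prop :=
  ∀ (n m : ℕ) (s : Fin m → Fin n × Fin n), (∀ t, (s t).1 ≠ (s t).2) → ∀ ν : Fin m → MeasureTheory.Measure Literature.MathematicalPhysics.KineticTheory.V3, (∀ t, MeasureTheory.IsProbabilityMeasure (ν t)) → (∀ t, ∀ᵐ ω ∂(ν t), ‖ω‖ = 1) → (∀ t, ∫ ω, ω ∂(ν t) = 0) → (∀ t (e : Literature.MathematicalPhysics.KineticTheory.V3), ∫ ω, (inner ℝ ω e) ^ 2 ∂(ν t) = ‖e‖ ^ 2 / 3) → ∀ (c : Fin n → Literature.MathematicalPhysics.KineticTheory.V3) (e :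 Literature.MathematicalPhysics.KineticTheory.V3), ∫ ωs, (∑ k, ((inner ℝ ((List.finRange m).foldl (fun c t => fun k => if k = (s t).1 then (1 / 2 : ℝ) • (c (s t).1 + c (s t).2) + (‖c (s t).1 - c (s t).2‖ / 2) • ωs t else if k = (s t).2 then (1 / 2 : ℝ) • (c (s t).1 + c (s t).2) - (‖c (s t).1 - c (s t).2‖ / 2) • ωs t else c k) c k) e) ^ 2 - ‖(List.finRange m).foldl (fun c t => fun k => if k = (s t).1 then (1 / 2 : ℝ) • (c (s t).1 + c (s t).2) + (‖c (s t).1 - c (s t).2‖ / 2) • ωs t else if k = (s t).2 then (1 / 2 : ℝ) • (c (s t).1 + c (s t).2) - (‖c (s t).1 - c (s t).2‖ / 2) • ωs t else c k) c k‖ ^ 2 * ‖e‖ ^ 2 / 3)) ∂(MeasureTheory.Measure.pi ν) = ∑ k, ((inner ℝ ((List.finRange m).foldl (fun c t => fun k => if k = (s t).1 ∨ k = (s t).2 then (1 / 2 : ℝ) • (c (s t).1 + c (s t).2) else c k) c k) e) ^ 2 - ‖(List.finRange m).foldl (fun c t => fun k => if k = (s t).1 ∨ k = (s t).2 then (1 /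 2 : ℝ) • (c (s t).1 + c (s t).2) else c k) c k‖ ^ 2 * ‖e‖ ^ 2 / 3)

/-- item stmt-AtomisticToContinuum-9235 · support · rank 9 · open · by planner
why it might fail: Cubic tails along the TRUE flow: energy conservation bounds only Σ|v|² ≤ CN, laws with H ≤ cN can put energy ~N on o(N) particles, the entropy inequality is void (∫_{|p|>M} e^{γ|p|³}·Maxwellian = ∞ at every cut-off); no N-uniform tail propagation known for hard spheres (OVY modify the KE).
sources: OllaVaradhanYau1993, NachtergaeleYau2003, Varadhan1993EntropyMethods, Literature.Barriers.AtomisticToContinuum.HighMomentumCutoffBarrierNarrow, Literature.Barriers.AtomisticToContinuum.lintegral_exp_cubic_eq_top, Spohn1991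
[crux] UNIFORM INTEGRABILITY OF THE CUBIC ENERGY CURRENT BEFORE THE FIRST SHOCK (shared typed crux
stmt-AtomisticToContinuum-3655 of route KineticWindows; the card's "cubic UI" conjunct X_T): for
continuous profiles ∃ σ₀ ∀ σ ∈ (0,σ₀) ∀ classical hs-Euler solutions on [0,T) ∀ flow families, if
the local Gibbs fields converge at t = 0 then ∀ t < T ∀ ε > 0 ∃ M ∃ N₀ ∀ N ≥ N₀ ∀ s ∈ [0,t]:
E[(N+1)⁻¹ Σ_i |v_i(s)|³ 1{|v_i(s)| > M}] ≤ ε. Needed here only for the energy equation (heat flux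
and (E+p)u): the quadratic momentum closure needs no tail input in this route (energy conservation +
the o(N) entropy bootstrap exclude sparse energy concentration, whose local-Gibbs cost is
extensive), but cubic mass on a vanishing fraction of particles has SUB-extensive cost. [difficulty:
open-problem] -/
@[route_item "route-AtomisticToContinuum-OneFlightGossipEngine"]
def EnergyCurrentTails : Prop :=
  ∀ (a₀ θ₀ : Literature.MathematicalPhysics.KineticTheory.T3 → ℝ) (u₀ : Literature.MathematicalPhysics.KineticTheory.T3 → Literature.MathematicalPhysics.KineticTheory.V3), Continuous a₀ → Continuous θ₀ → Continuous u₀ → (∀ x, 0 < a₀ x) → (∀ x, 0 < θ₀ x) → ∃ σ₀ : ℝ, 0 < σ₀ ∧ ∀ σ : ℝ, 0 < σ → σ < σ₀ → ∀ (T : ℝ) (ρ θ : ℝ → Literature.MathematicalPhysics.KineticTheory.T3 → ℝ) (u : ℝ → Literature.MathematicalPhysics.KineticTheory.T3 → Literature.MathematicalPhysics.KineticTheory.V3), Literature.MathematicalPhysics.KineticTheory.IsHardSphereEulerSolution σ T ρ u θ → ∀ Φ : (N : ℕ) → Literature.Analysis.FluidPDE.HardSphereFlow (Literature.Analysis.FluidPDE.Torus.geometry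 (Fin 3)) (Literature.MathematicalPhysics.KineticTheory.hsDiameter σ N) (N + 1), Literature.MathematicalPhysics.KineticTheory.TendstoHydroFieldsAt (fun N => Literature.MathematicalPhysics.KineticTheory.localGibbsLaw σ a₀ u₀ θ₀ N (Φ N)) Φ ρ u θ 0 → ∀ t ∈ Set.Ico 0 T, ∀ ε : ℝ, 0 < ε → ∃ M : ℝ, ∃ N₀ : ℕ, ∀ N : ℕ, N₀ ≤ N → ∀ s ∈ Set.Icc 0 t, ∫⁻ z, ENNReal.ofReal (((N : ℝ) + 1)⁻¹ * ∑ i : Fin (N + 1), Set.indicator {v : Literature.MathematicalPhysics.KineticTheory.V3 | M < ‖v‖} (fun v => ‖v‖ ^ 3) (((Φ N).flow s z i).2)) ∂(Literature.MathematicalPhysics.KineticTheory.localGibbsLaw σ a₀ u₀ θ₀ N (Φ N)) ≤ ENNReal.ofReal ε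

/-- item stmt-AtomisticToContinuum-9533 · aside · rank 9 · closed · proved by Summit.AtomisticToContinuum.HydrodynamicLimit.Theorems.gossipStressIdentity_proof (prover) · by planner
sources: doi:10.1109/tit.2006.874516, doi:10.1007/bf02392695, ChernovDolgopyat2009
[support] EXACT GOSSIP CLOSURE OF TRACELESS SECOND MOMENTS (card B2, exogenous schedule; provable
now). For n velocities c : Fin n → ℝ³, a schedule s : Fin m → Fin n × Fin n of pairs (i_t ≠ j_t) and
independent kicks ω_t ∼ ν_t with ν_t probability measures on ℝ³ carried by the unit sphere, mean
zero and isotropic second moments (∫⟪ω,e⟫² dν_t = |e|²/3): running the Kac/hard-sphere kinematics c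
↦ (c_i, c_j ← ½(c_i+c_j) ± ½|c_i−c_j| ω_t) along s, the expectation of Σ_k (⟪c_k,e⟫² − |c_k|²|e|²/3)
after the schedule equals the same traceless quadratic form evaluated at the GOSSIP-averaged
velocities (c_i, c_j ← ½(c_i+c_j) along s, no kicks), for every e. One step: ∫[⟪V±hω,e⟫² −
|V±hω|²|e|²/3]dν = ⟪V,e⟫² − |V|²|e|²/3, then induction + Fubini. Consequence: T_after =
Σ_k((Wc)_k)^{⊗2}°, W the product of averaging matrices; Σ_k W_{ka}² = meeting probability of two
schedule-driven walkers (≤ 2^{−#collisions} + P(hosts re-collide)). [difficulty: provable-now] -/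
@[route_item "route-AtomisticToContinuum-OneFlightGossipEngine"]
def GossipStressIdentity2 : Prop :=
  ∀ (n m : ℕ) (s : Fin m → Fin n × Fin n), (∀ t, (s t).1 ≠ (s t).2) → ∀ ν : Fin m → MeasureTheory.Measure Literature.MathematicalPhysics.KineticTheory.V3, (∀ t, MeasureTheory.IsProbabilityMeasure (ν t)) → (∀ t, ∀ᵐ ω ∂(ν t), ‖ω‖ = 1) → (∀ t, ∫ ω, ω ∂(ν t) = 0) → (∀ t (e : Literature.MathematicalPhysics.KineticTheory.V3), ∫ ω, (inner ℝ ω e) ^ 2 ∂(ν t) = ‖e‖ ^ 2 / 3) → ∀ (c : Fin n → Literature.MathematicalPhysics.KineticTheory.V3) (e : Literature.MathematicalPhysics.KineticTheory.V3), ∫ ωs, (∑ k, ((inner ℝ ((List.finRange m).foldl (fun c t => fun k => if k = (s t).1 then (1 / 2 : ℝ) • (c (s t).1 + c (s t).2) + (‖c (s t).1 - c (s t).2‖ / 2) • ωs t else if k = (s t).2 then (1 / 2 : ℝ) • (c (s t).1 + c (s t).2) - (‖c (s t).1 - c (s t).2‖ / 2) • ωs t else c k) c k) e) ^ 2 - ‖(List.finRange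 m).foldl (fun c t => fun k => if k = (s t).1 then (1 / 2 : ℝ) • (c (s t).1 + c (s t).2) + (‖c (s t).1 - c (s t).2‖ / 2) • ωs t else if k = (s t).2 then (1 / 2 : ℝ) • (c (s t).1 + c (s t).2) - (‖c (s t).1 - c (s t).2‖ / 2) • ωs t else c k) c k‖ ^ 2 * ‖e‖ ^ 2 / 3)) ∂(MeasureTheory.Measure.pi ν) = ∑ k, ((inner ℝ ((List.finRange m).foldl (fun c t => fun k => if k = (s t).1 ∨ k = (s t).2 then (1 / 2 : ℝ) • (c (s t).1 + c (s t).2) else c k) c k) e) ^ 2 - ‖(List.finRange m).foldl (fun c t => fun k => if k = (s t).1 ∨ k = (s t).2 then (1 / 2 : ℝ) • (c (s t).1 + c (s t).2) else c k) c k‖ ^ 2 * ‖e‖ ^ 2 / 3)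

/-- item stmt-AtomisticToContinuum-9534 · support · rank 9 · closed · proved by Summit.AtomisticToContinuum.HydrodynamicLimit.Theorems.kacPairHeatFlux_proof (prover) · by planner
sources: doi:10.1512/iumj.1956.5.55001, doi:10.1007/bf02392695, doi:10.1142/s0218202515500256
[support] ONE KAC COLLISION DAMPS THE PAIR HEAT FLUX BY 2/3 AND SPLITS IT EVENLY (card B2, cubic;
provable now). For independent ℝ³-valued velocities x ∼ μ, y ∼ μ′ (probability laws with finite
third moments and mean zero) and an independent kick ω ∼ ν (probability law on the unit sphere,
symmetric under ω ↦ −ω, isotropic second moments), the post-collisional velocity x′ = ½(x+y) +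
½|x−y|ω satisfies E[⟪x′,e⟫|x′|²] = (E[⟪x,e⟫|x|²] + E[⟪y,e⟫|y|²])/3 for every e (and the same for y′
= ½(x+y) − ½|x−y|ω by symmetry of ν). Proof: E_ω[⟪V+hω,e⟫|V+hω|²] = ⟪V,e⟫(|V|² + (5/3)h²), then
E⟪V,e⟫|V|² = E⟪V,e⟫h² = (q_x+q_y)/8. Iterated along a tree schedule: the (2/3)-damped gossip.
[difficulty: provable-now] -/
@[route_item "route-AtomisticToContinuum-OneFlightGossipEngine"]
def KacPairHeatFlux : Prop :=
  ∀ (μ μ' ν : MeasureTheory.Measure Literature.MathematicalPhysics.KineticTheory.V3), MeasureTheory.IsProbabilityMeasure μ → MeasureTheory.IsProbabilityMeasure μ' → MeasureTheory.IsProbabilityMeasure ν → MeasureTheory.Integrable (fun x => ‖x‖ ^ 3) μ → MeasureTheory.Integrable (fun y => ‖y‖ ^ 3) μ' → ∫ x, x ∂μ = 0 → ∫ y, y ∂μ' = 0 → (∀ᵐ ω ∂ν, ‖ω‖ = 1) → ν.map (fun ω => -ω) = ν → (∀ e : Literature.MathematicalPhysics.KineticTheory.V3, ∫ ω, (inner ℝ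 ω e) ^ 2 ∂ν = ‖e‖ ^ 2 / 3) → ∀ e : Literature.MathematicalPhysics.KineticTheory.V3, ∫ x, ∫ y, ∫ ω, inner ℝ ((1 / 2 : ℝ) • (x + y) + (‖x - y‖ / 2) • ω) e * ‖(1 / 2 : ℝ) • (x + y) + (‖x - y‖ / 2) • ω‖ ^ 2 ∂ν ∂μ' ∂μ = ((∫ x, inner ℝ x e * ‖x‖ ^ 2 ∂μ) + (∫ y, inner ℝ y e * ‖y‖ ^ 2 ∂μ')) / 3

-- earlier ClampedTransferDock (stmt-AtomisticToContinuum-16657, replaced 2026-08-16T20:44:55Z -> stmt-AtomisticToContinuum-16665): retired by None — CollisionActivityTails → EnergyCurrentTails → DiluteSelfConsistency → _root_.HydrodynamicLimit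
-- earlier ClampedTransferDock (stmt-AtomisticToContinuum-16665, replaced 2026-08-16T23:23:53Z -> stmt-AtomisticToContinuum-17615): retired by None — KineticCurrentsLDAlongFamilies → CollisionActivityTails → EnergyCurrentTails → DiluteSelfConsistency → _root_.HydrodynamicLimit
/-- item stmt-AtomisticToContinuum-17615 · support · rank 10 · closed · moot by None · by planner
why it might fail: Closes only through three further conjecture-grade inputs (weighted coherence, local TRANSFER-clamped LD along families, energy-activity tails) whose glued split is requested, not filed; as strong as KCWF ∧ CAT ∧ ECT ⇒ HL(guarded); fragile: cubic channel at fixed tilt, EOS at packing ~η₀.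
sources: Yau1991, OllaVaradhanYau1993, KipnisLandim1999, Varadhan1993EntropyMethods, Spohn1991, Serre2021
[crux] THE DOCK, DSC-FREE (rev 29, route-repair after the statement re-type D-0032 / p126922;
restates the rev-25 stmt-16665 KCWF → CAT → ECT → DSC → HL 1:1 without its idle antecedent):
KineticCurrentsLDAlongFamilies → CollisionActivityTails → EnergyCurrentTails → HydrodynamicLimit,
where HydrodynamicLimit is now the PACKING-GUARDED conjunct (∃η₀ outermost; hypothesis ∀t<T ∀x
ρ_t(x)σ³ < η₀ on the classical solution; verbatim HydroLimitInBandDim 3, Iff.rfl with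
ImplosionDichotomy.HydroLimitInBand). Yau's Liouville-invariant relative entropy along the explicit
reference family a_s = ρ_s·Rf(σ³ρ_s) with ONE common window; the guard (given) is exactly what keeps
a_s in the low-density chart of HsEosLowDensity / UniformLocalGibbsConcentration (both PROVED) — the
job DiluteSelfConsistency (3091, open-problem grade) did before the re-type (dock disprover's
finding F1-DSC-IDLE; Negative/DockShape `not_dockWithoutDSC_iff` is this statement's shape lemma).
REACHED THROUGH THREE FURTHER CONJECTURE-GRADE INPUTS, typed by the planner (Iff.rfl-identical with
the dock line's landed Theorems copies; evidence SPLIT-REQUEST.md + children.json + Sketch.lean on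
stmt-16665) and REQUESTED as this node's -/
@[route_item "route-AtomisticToContinuum-OneFlightGossipEngine"]
def ClampedTransferDock : Prop :=
  KineticCurrentsLDAlongFamilies → CollisionActivityTails → EnergyCurrentTails → _root_.HydrodynamicLimit

-- earlier Assembly (stmt-AtomisticToContinuum-14573, replaced 2026-08-16T04:21:59Z -> stmt-AtomisticToContinuum-14661): retired by None — KineticCurrentsWindowLD → CollisionalWindowLD → EnergyCurrentTails → LocalGibbsConcentration → HsEosLowDensity → _root_.HydrodynamicLimit
-- earlier Assembly (stmt-AtomisticToContinuum-14647, replaced 2026-08-16T20:44:55Z -> stmt-AtomisticToContinuum-16666): retired by None — OneFlightLayeredChaos → KineticCurrentsWindowLDUniform → EquilibriumClampedCollisionalWindowLD → CollisionActivityTails → EnergyCurrentTails → DiluteSelfConsistency → _root_.HydrodynamicLimit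
-- earlier Assembly (stmt-AtomisticToContinuum-14661, replaced 2026-08-16T04:53:49Z -> stmt-AtomisticToContinuum-14647): retired by None — OneFlightLayeredChaos → KineticCurrentsWindowLDUniform → EnergyCurrentTails → _root_.HydrodynamicLimit
-- earlier Assembly (stmt-AtomisticToContinuum-16666, replaced 2026-08-16T23:23:53Z -> stmt-AtomisticToContinuum-17616): retired by None — OneFlightLayeredChaos → KineticCurrentsLDAlongFamilies → CollisionActivityTails → EnergyCurrentTails → DiluteSelfConsistency → _root_.HydrodynamicLimit
-- earlier Assembly (stmt-AtomisticToContinuum-9536, replaced 2026-08-16T03:32:23Z -> stmt-AtomisticToContinuum-14573): retired by None — KineticCurrentsWindowLD → EnergyCurrentTails → LocalGibbsConcentration → HsEosLowDensity → EngineDock → RelEntropyToLimit → _root_.HydrodynamicLimit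
/-- item stmt-AtomisticToContinuum-17616 · assembly · rank 1 · closed · moot by None · by planner
sources: Yau1991, OllaVaradhanYau1993, KipnisLandim1999
[assembly] X_OF ⟹ CONJUNCT (rev 29; the frame statement `thesis → Statement` with X_OF = the Lean
line of the thesis minus the dock): OneFlightLayeredChaos → KineticCurrentsLDAlongFamilies →
CollisionActivityTails → EnergyCurrentTails → HydrodynamicLimit (the packing-guarded conjunct). Not
the deciding theorem (`closes` is, D-0027 §2.1) and deliberately WITHOUT the dock
ClampedTransferDock among its antecedents; it is definitionally OneFlightLayeredChaos →
ClampedTransferDock (Theorems/OneFlightGossipEngineAssemblyDock `…assembly_iff_clampedTransferDock`,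
Iff.rfl again after the simultaneous rev-29 restate), hence the dock's one-line consequence `fun _
hK h₇ h₆ => hD hK h₇ h₆`, and records that the mechanism crux B1′ sits upstream of the docking node.
Restates the rev-25 frame stmt-16666 1:1 without the antecedent DiluteSelfConsistency, idle since
the statement re-type D-0032 (the packing guard is a hypothesis of the conjunct). -/
@[route_item "route-AtomisticToContinuum-OneFlightGossipEngine"]
def Assembly : Prop :=
  OneFlightLayeredChaos → KineticCurrentsLDAlongFamilies → CollisionActivityTails → EnergyCurrentTails → _root_.HydrodynamicLimit

-- records of items no longer active in this route (dropped / restated):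
-- earlier EquilibriumClampedCollisionalWindowLD (stmt-AtomisticToContinuum-13733, replaced 2026-08-16T20:38:33Z -> stmt-AtomisticToContinuum-16623): refuted by Summit.AtomisticToContinuum.HydrodynamicLimit.Theorems.OneFlightGossipEngineEquilibriumClampedCollisionalWindowLD_refuted @ 8061795fe1a3 — ∃ σ₀ : ℝ, 0 < σ₀ ∧ ∀ (a₀ θ₀ : ℝ) (u₀ : Literature.MathematicalPhysics.KineticTheory.V3), 0 < a₀ → 0 < θ
-- earlier ClampedCurrentsDock (stmt-AtomisticToContinuum-14673, replaced 2026-08-16T05:47:55Z -> stmt-AtomisticToContinuum-14680): retired by None — KineticCurrentsWindowLDUniform → EquilibriumClampedCollisionalWindowLD → CollisionActivityTails → EnergyCurrentTails → HsEosLowDensity → DiluteSelfConsistency → _root_.HydrodynamicLimit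
-- earlier ClampedCurrentsDock (stmt-AtomisticToContinuum-14680, replaced 2026-08-16T20:36:54Z -> stmt-AtomisticToContinuum-16657): retired by None — KineticCurrentsWindowLDUniform → EquilibriumClampedCollisionalWindowLD → CollisionActivityTails → EnergyCurrentTails → DiluteSelfConsistency → _root_.HydrodynamicLimit
-- earlier CollisionalWindowLD (stmt-AtomisticToContinuum-9689, replaced 2026-08-16T03:03:11Z -> stmt-AtomisticToContinuum-14116): retired by None — [support; child of the foreseen split of EngineDock; crux-level for the architecture] COLLISIONAL-TRANSFER WINDOW LD (card kinetic-windows-inside-yau crux 1, collisional part; ex-stmt-AtomisticToContinuum-3678 of the retired route KineticWindows; typable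

/-! D-0027 §2.1 — DECIDING THEOREM (planner-authored via `route open/edit --closes-file`; by planner-rfix-AtomisticToContinuum-OneFlightG-1022be7d-g2-0 2026-08-17T07:23:25Z) — ARCHIVED: route closed (refuted) 2026-08-20T06:49:33Z; kept so importers keep building:
its hypotheses are this route's items and its conclusion the sub-problem Statement (glue_lint), and it elaborates with this file. -/

@[closes "route-AtomisticToContinuum-OneFlightGossipEngine"] theorem closes (hK : KineticCurrentsLDAlongFamilies) (h₇ : CollisionActivityTails)
    (h₃ : LocalClampedTransferLDAlongFamilies) (hQ : KineticCurrentsLDAlongFamiliesQ)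
    (hS : SuperExponentialEnergyTails) (h₄ : EnergyActivityTails)
    (hD : ClampedTransferDockOfInputsQ) : _root_.HydrodynamicLimit :=
  hD hS hQ h₃ h₄ hK h₇

end Summit.AtomisticToContinuum.HydrodynamicLimit.Theses.OneFlightGossipEngine
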